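import Literature.NumberTheory.Rogawski1990.CohomologicalFinComponentIsTheta
import Literature.NumberTheory.Automorphic.UnitaryGroupPlaceInclusion
import Literature.NumberTheory.Automorphic.Liu2021.Def411WeilCarriersLocalIsotypyAtPlace
import Literature.NumberTheory.Automorphic.Liu2021.Def411WeilCarriersLocalTypesOfEquiv
import Literature.NumberTheory.Automorphic.UnitaryGroupLocalCongr
import Literature.RepresentationTheory.Liu2021.GlobalOscillatorIsomorphismCriterion
import Literature.NumberTheory.GelbartRogawski1991.FiniteAdelicWeilCentralCoinvariantsIsotypic
import Literature.NumberTheory.Automorphic.IrreducibleClassesComap                     -- ★ `IrrClass.comap`, `comap_surjective`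
import Literature.NumberTheory.Rogawski1990.GlobalAPacketLetters                          -- ★ p812883 (typ3 round 2): the named fact S2♭ `cohDiscrete_memXiFamily` (BY NAME)
import Literature.NumberTheory.GelbartRogawski1991.XiEnvelopeNonsplitThetaType         -- ★ D7α (F0-typ3 (g5)): the PRINT letter `xiEnvelope_nonsplit_isThetaType` (BY NAME, v1.2)
import Literature.NumberTheory.GelbartRogawski1991.WeilLiftNonsplitPrincipalSeriesConstituent  -- ★ p818501 U′-N (F0-typ1 (g5)): the PRINT letter `GR91Lemma512NonsplitAsPrinted` (BY NAME, v1.4)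
import Summits.HodgeConjecture.HodgeConjecture.Theorems.F0P2oGR91NOfLetters                   -- ★ p828472 B-p14 (g27): the Lines-free TWIN `GR91N_of_letters (hN3) (hW) (hU1)` of the parent pay-down line's composition (v1.5)
import Summits.HodgeConjecture.HodgeConjecture.Theorems.F0P2oXiLocalPacketThetaPairOfLetters    -- ★ p829745 B-p14 (g27): the Lines-free TWIN `xiLocalPacket_nonsplit_isThetaPair_of_letters` (#75-loc ⟸ N3, K1w, U1, N6, LABEL) (v1.7)
import Summits.HodgeConjecture.HodgeConjecture.Theorems.F0P2oD7alphaMembersThetaClass           -- ★ p830189 B-p14 (g27): `d7alpha_members_thetaClass` (record members are theta types) (v1.7)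
import Summits.HodgeConjecture.HodgeConjecture.Theorems.F0P2oIsoAtXfOfThetaTypeAt                 -- ★ p830228 A-p12 (g17): ISO-BRIDGE `exists_isoAtXfCM_of_forall_mem` (v1.7)
import Literature.NumberTheory.Rogawski1990.CMThetaDockingClauses                                -- ★ the theta-docking clause `CMThetaDockingClauses` (v1.7)
import Literature.NumberTheory.Rogawski1990.U3SupercuspidalJacquetCriterion                      -- ★ p826085 typ-T7a: THE N6 LETTER `u3_isSupercuspidal_iff_jacquet_eq_zero` (BY NAME, v1.7)
import Literature.NumberTheory.Automorphic.U3JacquetVanishingSupercuspidal   -- ★ p831380 A-p16 (g23) over ★ B-p17 (g21) (δ): `u3_isSupercuspidal_iff_jacquet_eq_zero_holds` — THE N6 LETTER PROVED IN-HOUSE (v1.8)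
import Literature.NumberTheory.Rogawski1990.U3SquareIntegrabilityExponentCriterion              -- ★ typ-T7b (g0): THE N7 LETTER `u3_squareIntegrable_jacquetExponent_decay` (row N7; BY NAME, v1.9)
import Summits.HodgeConjecture.HodgeConjecture.Theorems.F0P2pK1wHolds   -- ★ p833012 F0P2-p06 (g2): K1w HYPOTHESIS-FREE `cmPrincipalSeries_isConstituentOf_weylConj_holds` (over ★ p832032 + ★ p832625 N1), BY NAME (v1.11)
import Summits.HodgeConjecture.HodgeConjecture.Theorems.F0P2pGR91NOfN3   -- ★ p833094 F0P2-p06 (g2): `u1ThetaDichotomy_nonsplit_of_N3 (hN3)`, `GR91Lemma512NonsplitAsPrinted_of_N3 (hN3)` (U1 ∕ #76 modulo N3 only), BY NAME (v1.11)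
import Summits.HodgeConjecture.HodgeConjecture.Theorems.F0P2oN3OfTorusWeight   -- ★ p835661 F0P2-p06 (g3): THE N3 PACKAGER `thetaType_nonsplit_jacquetModule_of_a_of_torusWeight (hA) (hD)` over ★ p835430 (b)-assembler `F0P2oN3TorusWeightOfD3d`, BY NAME («N3 SPLIT», edition v1.12)
import Summits.HodgeConjecture.HodgeConjecture.Theorems.F0P2oN3TorusWeightHolds   -- ★ A-p16 (g24) (5c): `forall_jacquetModule_xThetaGqsCM_torus_eq_smul` = the packager՚s (hD) binder PROVED (token for token) ⇒ `stub_N3D_letter` closed BY NAME («N3D FOLD»)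
import Summits.HodgeConjecture.HodgeConjecture.Theorems.F0P2oLineJacquetHolds   -- ★ p839151 F0P2-p06 (g4) (JA): `thetaType_nonsplit_jacquetModule_holds : GelbartRogawski1991.thetaType_nonsplit_jacquetModule` HYPOTHESIS-FREE ⇒ `stub_N3_letter` closed BY NAME («N3 DIRECT FOLD»)
import Summits.HodgeConjecture.HodgeConjecture.Theorems.F0P2oD7alphaMemDockStatement   -- ★ p839951 F0P2-p01 (g9): `StubD7αMemDockPerMeasure` — the D7α node of record PER MEASURE (body pin 88b1609ac8246fc6, ref1 r237∕r238) ⇒ `stub_D7αMemDockμ` BY NAME («D7α RE-CUT BY NAME»)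
import Summits.HodgeConjecture.HodgeConjecture.Theorems.F0P2oD7alphaMembersThetaClassTest   -- ★ p840385 F0P2-p06 (g5): packet-level glueᵀ `d7alpha_packet_members_thetaClassTest` (Test-(13.1.4) completion ⇒ members are CM theta types)
import Summits.HodgeConjecture.HodgeConjecture.Theorems.F0P2oD7alphaMemDockStatementW1      -- ★ p849450 F0P2-p06 (g14) ROAD W (c): the W1 node `StubD7αMemDockPerMeasureTW1` (DOCKᵀ on the weight-one automorphic locus) + `_toW1` (v1.16 «W1»)
import Summits.HodgeConjecture.HodgeConjecture.Theorems.F0P2oD7alphaMembersThetaClassTestW1  -- ★ p849454 F0P2-p06 (g14) ROAD W (f1): W1 packet-level glueᵀ `d7alpha_packet_members_thetaClassTestW1` (fed `hw haut`) (v1.16 «W1»)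
import Summits.HodgeConjecture.HodgeConjecture.Theorems.F0P2oN7OfCasselmanCriterion   -- ★ p835805 A-p13 (g27): Casselman՚s criterion ⇒ for the quasi-split `U(3)` at a non-split place over #109 N5 ★ p834912 — `u3_squareIntegrable_jacquetExponent_decay_holds`, HYPOTHESIS-FREE ⇒ `stub_N7_letter` closed BY NAME («N7 FOLD»; books #110 −1 at this REGISTERED edition)
import Summits.HodgeConjecture.HodgeConjecture.Theorems.F0P2oThetaTypeNotL2   -- ★ p831648 B-p18 (g28): LABEL `thetaType_not_squareIntegrable (hN3) (hN6) (hN7)` (Lines-free Theorems file, BY NAME, v1.9)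
import Literature.NumberTheory.GelbartRogawski1991.ThetaTypeNonsplitJacquetModule          -- ★ p826177 typ-T7a (g0): THE N3 LETTER `thetaType_nonsplit_jacquetModule` (BY NAME, v1.5)
import Literature.NumberTheory.Rogawski1990.U3PrincipalSeriesWeylConjugate                -- ★ p826332 typ-T7a (g0): THE K1w LETTER `cmPrincipalSeries_isConstituentOf_weylConj` (BY NAME, v1.5)
import Literature.NumberTheory.GelbartRogawski1991.U1ThetaDichotomy                        -- ★ p826953∕p827180 typ-T7b (g0): THE U1 LETTER `u1ThetaDichotomy_nonsplit` (BY NAME, v1.5)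
import Summits.HodgeConjecture.HodgeConjecture.Theorems.F0P2iGRDWitness                      -- p819322 (F0P2-p01 (g5)): DICT-CHOICE witness `grdMu`, `grdChi` + pins (v1.4)
import Summits.HodgeConjecture.HodgeConjecture.Theorems.F0P2iGRDAssembly                     -- A-p17 (g15): pinned GRD core `grdMatrix_grdMu_grdChi_of_GR91N` (v1.4)
import Summits.HodgeConjecture.HodgeConjecture.Theorems.F0P2iRIGinfDischarge                 -- ★ p819114 (B-p18 (g26)): `rigInf_node_of_xiArchPinned` over ★ `XiArchPinned` p818382 + ★ `stubRIGinfArith_holds` p818525 (v1.4)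
import Summits.HodgeConjecture.HodgeConjecture.Theorems.F0P3CompactTrivOfRecord                 -- ★ p819716 (F0P3): `cmCompactFactor_rightRegular_eq_self_of_isHolOrAntihol` (C2♯'s `Kc`-binder, v1.4)
import Literature.RepresentationTheory.HarrisKudlaSweet1996.SplittingCharactersCM                   -- ★ `IsSplittingChar.exists_hasUnitaryArchType` (μω's odd unitary arch type, v1.4)
import Literature.NumberTheory.Rogawski1990.CohDiscreteMemXiFamilyArchPinned             -- ★ S2♯ (F0-typ3 (g6), DEF lane): the print-derived letter `cohDiscrete_memXiFamily_archPinned` (BY NAME, v1.4b)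
import Summits.HodgeConjecture.CorCM.B01.Transposition.Item6OmegaChiSplitting           -- `OmegaChiSplitting.chiLocalSplittingsD` (★ B01)
import Summits.HodgeConjecture.HodgeConjecture.Theorems.F0P2cOmegaLocalType              -- ★ p803803 F0P2-p01 (g3): CE-L `formCongr_frame`
import Summits.HodgeConjecture.HodgeConjecture.Theorems.F0P3MemXiFamilyTransfer          -- ★ F0P3-p04 (g5): `exists_muOmega`; imports ★ T♭-core `smoothConstituents_iff_of_hasFinComponent`
import Summits.HodgeConjecture.HodgeConjecture.Theorems.F0P3SLayerFoldShapes             -- ★ F0P3-p03 (g5): token producer `exists_cohToken_of_isHolOrAntihol_cpt`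
import Summits.HodgeConjecture.HodgeConjecture.Theorems.F0P2cStubCLLocalTypeExists       -- ★ CL (rung 2, CE side): LOCAL TYPES EXIST `stubCL_holds` (Flath) — LTY-τ BY NAME
import Summits.HodgeConjecture.HodgeConjecture.Theorems.F0P2hLTYLocalConstituents        -- ★ p816375 (F0P2-p01 (g5)): LTY-c `exists_member_isConstituentOf_localType` — LTY BY NAME
import HarnessLib

/-!
# Crux `H413` · programme P2 (theta ∕ `hdictE`) · RUNG 4 of the engine letter PKΠ — sub-line `F0_P2PKPiRung4` (edition v1.15 «DOCK-T» over v1.14 «D7α RE-CUT BY NAME» over v1.13 «N3 DIRECT FOLD» over v1.12 «N3 SPLIT + N3D FOLD + N7 FOLD» over v1.11 «N1 DROP + HOLDS FOLD» over v1.10 «N6 + LABEL + K1w + U1 FOLD» over v1.7 «D7α SPLIT» — the boxed pre-writes v1.8∕v1.9 are folded in and were never written — F0P2-plan (g8); v1.5 «GR91N FOLD», F0P2-plan (g8); v1.4 «S2♯∕GRD∕RIG∞-FOLD», F0P2-plan (g6))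

**PKΠ ⟸ S2♭ + GRD + RIG∞ + RIGf (+ ★LTY by name).**  Cell hodgecm-mathlib (D-0151), FLOOR 0, crux item H413 = stmt-HodgeConjecture-24833, route of record
`HCCMUnconditional` (binder `h413 ⇐ hdictE`).  HONEST LABEL: HC_CM is proved only modulo the printed citations until rung 0 closes; this file PROVES
NOTHING new about HC_CM — it RE-CUTS the ONE remaining live `sorry` of the PK rung-3 sub-line `Lines/F0_P2PKRung3.lean` v1.2
(`stub_PKPi_placewiseMembership`, PKΠ = ENGINE letter U: «for a cotangent discrete `P` of `U(H)` with finite component `σ`: ∃ `μ` conjugate-symplectic of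
weight one and `χ ∈ Chi` such that at EVERY finite place `v` some line class `ε_v` makes `σ ∘ inclPlace v` `X_v(μ,ε_v,χ) ∘ κ_v⁻¹`-isotypic») INTO
programme P3's typed packet vocabulary D5∕D6 ED.2 (★ `OneDimAutRepH`, ★ `MemXiFamily`, typ3 round 2, p814855) — the §4 LEVEL-B INTERFACE of rung 3
(`pkPi_matrix_of_SLayer_rows` over an ABSTRACT `(Ξ, Mem)`) INSTANTIATED at `(Ξ, Mem) := (OneDimAutRepH L, MemXiFamily)`, with the dictionary row DICT split
into its honest parts.

EDITION v1.1 (F0P2-p01 (g5) typing note 08:30:09Z, adopted): the dictionary's `χf` is UNITARY — `StubGRD` outputs `Continuous χf ∧ (∀ z, ‖χf z‖ = 1) ∧ …`,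
`StubRIGinf`∕`StubRIGf` receive both clauses as hypotheses (at a split place `U(1)(L⁺_v) ≅ L_wˣ` is not compact, so unitarity is not automatic; the ★ split
model p816652 needs it).  `PKPiTarget`, `IsoAt`, `IsoAtXf`, `ThetaTypeAt`, `GRDMatrix` are byte-identical to edition v1 (commit 0f4dd3c8977f).  The witness
pair `(μ₀, χf)` is NOT defined here: DICT-CHOICE protocol — named defs `grdMu`∕`grdChi` live in a prover-owned Theorems helper (`F0P2iGRDWitness`), both the
(S) and the (N) closer are typed against those names, and `stubGRD_holds : StubGRD` assembles them (bus 08:32:01Z).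

EDITION v1.2 «RIGf-FOLD» (director s515 (A) ∕ s522; F0P3-plan RULING (V16); bytes F0P2-plan (g6), written by A-plan1 (g19)): the engine stub `stub_RIGf` is
DISCHARGED modulo ONE PRINTED LETTER BY NAME — ★ `Literature.NumberTheory.GelbartRogawski1991.xiEnvelope_nonsplit_isThetaType` (D7α, F0-typ3 (g5), k = 1 on
the fan-B ledger: «in a ξ-envelope satisfying the finite Gelbart–Rogawski dictionary, the local class of an automorphic `P` at a NON-SPLIT place is a
`(μ,χf)`-theta type of some line class» [Rogawski1990 Thm 13.3.3, Thm 13.3.6 (c), Prop 13.1.3 (d), §12.2 (2); GelbartRogawski1991 Lem 5.1.2, Prop 5.2.2;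
GelbartRogawskiSoudry1997 Prop 2.5.1 (b)], stated over the shared vocabulary ★ `GelbartRogawski1991.CMThetaTypeVocabulary` (A-p17 (g15), p818127) whose
`IsoAtXfCM`∕`ThetaTypeAtCM`∕`GRDMatrixCM` agree with this file's `IsoAtXf`∕`ThetaTypeAt`∕`GRDMatrix` DEFINITIONALLY): `theorem stub_D7α : xiEnvelope_nonsplit_isThetaType
:= by sorry` is the registered PRINT stub, `stubRIGf_of_D7α` the adapter (ONE `intro` + ONE `exact`, cert ef070325989a7f21), and `stub_RIGf : StubRIGf :=
stubRIGf_of_D7α stub_D7α` carries NO `sorry`.  Registered sorry set of this edition: {`stub_S2` (S2♭, engine∕P3), `stub_GRD` (GRD; fold pending = «GRD-FOLD»: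
`stubGRD_of_GR91N stub_GR91N`, A-p17), `stub_RIGinf` (RIG∞; in-house discharge pending = ★-to-be `F0P2iRIGinfArith.stubRIGinfArith_holds` over `XiArchPinned` +
S2♯), `stub_D7α` (PRINT)} — count 4 → 4.  Every `def` of §0–§1 and the head `pkPi_of_rung4` are BYTE-IDENTICAL to v1.1 (commit 332357cf92ad).

EDITION v1.4 «S2♯∕GRD∕RIG∞-FOLD» (director s528 (2): S2♭ → S2♯ registered-letter SWAP GO, count-neutral; bytes F0P2-plan (g6), written by A-plan1 (g19)).  THE HEAD IS
RE-CUT: (i) S2♯ — «a cotangent (hol ∨ antihol at `ι`, trivial on the compact factor) discrete `P` lies in the ξ-local family of a one-dimensional automorphic `ξ`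
of `U(2)×U(1)` AND `ξ_∞` is pinned against `μω`'s archimedean type: `XiArchPinned L ξ μω k`» — replaces S2♭ + the `(𝔤,K)`-token detour; statement owner F0P3-plan
(letter `cohDiscrete_memXiFamily_archPinned`, DEF lane); v1.4 carried the LOCAL PLACEHOLDER TYPE `def C2SharpLetter : Prop` (§1) = P3's (C2♯) conjunct text VERBATIM (F0P3-plan x-post 10:16:00Z) with
`stub_S2sharp : C2SharpLetter`; EDITION v1.4b (this text) types the registered stub BY NAME `stub_S2sharp : Literature.NumberTheory.Rogawski1990.cohDiscrete_memXiFamily_archPinned`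
(★ F0-typ3 (g6); its body ↔ `C2SharpLetter` is `Iff.rfl`, recorded below as `c2SharpLetter_iff_letter`), with the 6-line adapter `s2SharpExport_of_C2sharp` to this file's export shape `S2SharpExport`; (ii) GRD is consumed PINNED at the DICT-CHOICE witness
`(μ_ξ, χ_f) := (grdMu L ξ μω hμu, grdChi L ξ μω hquad)` (p819322): `GRDMatrix … (grdMu …) (isConjugateSymplectic_grdMu …) (grdChi …)` := A-p17's pinned core
`F0P2iGRDAssembly.grdMatrix_grdMu_grdChi_of_GR91N stub_GR91N …` ((S) = ★ p817998 at the pins (Dν)∕(Dψ); (N) = the PRINT letter ★ p818501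
`GR91Lemma512NonsplitAsPrinted.nonsplit` at the pins `semilocalComponent_toHeckeCharacter_grdMu`∕`grdChi_finAdelicCheck`); registered `stub_GR91N`; (iii) RIG∞ is
DISCHARGED IN-HOUSE with NO `sorry`: `rigInf_node_of_xiArchPinned L ξ μω k hpin (grdMu …) (toHeckeCharacter_grdMu …) (grdChi …) (grdChi_finAdelicCheck …)` (★ p819114 ←
★ p819050 ← ★ p818525 `stubRIGinfArith_holds` ← ★ p818382 `XiArchPinned`); (iv) RIGf as in v1.2 (`stub_RIGf := stubRIGf_of_D7α stub_D7α`), instantiated at the witness.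
REGISTERED SORRY SET v1.4 = {`stub_S2sharp` (S2♯, print-derived, P3), `stub_GR91N` (print #76), `stub_D7α` (print #75)} — PRINT ONLY, engine count 0 on this sub-line;
`StubGRD` (∃-form) and `StubRIGinf` (∀-form) of v1.1 stay in §1 as unregistered history (`StubGRD` still follows: `F0P2iGRDAssembly.stubGRD_of_GR91N`).  `PKPiTarget`,
`IsoAt`, `IsoAtXf`, `ThetaTypeAt`, `GRDMatrix`, `StubGRD`, `StubRIGinf`, `StubRIGf`, §4 are BYTE-IDENTICAL to v1.1∕v1.2.  HYGIENE (A-plan1 10:27:52Z, s355): the `[cite: …]` tags inside the `def` docstrings are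
re-worded «(print: …)» (docstring-only; every statement text unchanged).

EDITION v1.5 «GR91N FOLD» (F0P2-plan (g8), 2026-08-31; director s596 (1): count-neutral).  The registered print stub `stub_GR91N` (letter #76 U′-N
`GR91Lemma512NonsplitAsPrinted`) is CLOSED BY NAME over the Lines-free `Theorems/` twin ★ p828472 `F0P2oGR91NOfLetters.GR91N_of_letters stub_N3_letter stub_K1w_letter
stub_U1_letter` (B-p14 (g27); = the composition `GR91N_of_stubs` of the pay-down line `Cruxes/H413/Lines/F0_P2GR91NJacquet.lean` v1.2 bc8c0266be4a over ★ p828142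
`F0P2oThetaInPSOfLetters.stubThetaInPS_of_letters` (K1: B-p18 (g28), p01, p02, p05, A-p12) + ★ p826011 `F0P2oStubDictTorusChar.stubDictTorusChar_holds` (K2: F0P2-p02 (g5)); desk by-paste
cert 3863ad90d1f712f0 TRIO).  Under it, as `sorry`s over ★-typed named Literature facts: `stub_N3_letter` [GelbartRogawski1991 §3.2 (3.2.1)–(3.2.2) p. 457; Kudla1986 Thm. 2.8]
(★ p826177), `stub_K1w_letter` [Rogawski1990 §12.1 p. 172, §12.2 p. 174; BernsteinZelevinsky1977 Thm. 2.9] (★ p826332), `stub_U1_letter` [HarrisKudlaSweet1996 Cor. 4.4;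
Rogawski1992 Prop. 3.4] (★ p826953∕ED. 2 p827180; in-house road (T) «up the tower» live: ★ p828212∕p828329 `u1ThetaDichotomy_nonsplit_of_disjoint (hdisj)`).  REGISTERED SORRY SET
v1.5 = {`stub_S2sharp` (S2♯, P3), `stub_N3_letter` (#96), `stub_K1w_letter` (#98), `stub_U1_letter` (#97), `stub_D7α` (#75)} — PRINT 5 ∕ ENGINE 0; `stub_GR91N` and `stub_RIGf`
carry no `sorry`.  Every `def`, the head `pkPi_of_rung4` and the concluder are BYTE-IDENTICAL to v1.4b (no `Cruxes/…/Lines` import, O50-1).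

EDITION v1.7 «D7α SPLIT» (F0P2-plan (g8), 2026-08-31; PLAN-P2.v8 §3; ref1 r177–r179 boxes; director s616).  The registered print stub `stub_D7α` (letter #75
`xiEnvelope_nonsplit_isThetaType`, the ENVELOPE form) is RETIRED together with its adapter `stubRIGf_of_D7α` and `stub_RIGf` (ref1 r179 N4: deleted, not left dead), because
the envelope form is unlabelled at the representation level (α), needs restricted-tensor isotypy to reach `IsoAtXf` (β) and leaves the docking data unbound (γ).  In its place:
(i) `def StubRIGfDict` = `StubRIGf` VERBATIM except that the binder `GRDMatrix … →` is replaced by the two DICTIONARY equations of letters #75∕#76 (`(toHeckeCharacter L μ1).semilocalComponent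
… = (ξ.bcη⁻¹ * ξ.bcψ⁻¹ * μω).semilocalComponent …` and the `finAdelicCheck` clause) — the head only ever applied RIGf at the GRD witness `(grdMu, grdChi)`, where they hold by ★
`F0P2iGRDWitness.semilocalComponent_toHeckeCharacter_grdMu`∕`grdChi_finAdelicCheck` (the 2-token witness edit in the non-split branch of the head); the head hypothesis
`(hRIGf : StubRIGf)` is re-typed `(hRIGf : StubRIGfDict)` and the CONCLUSION `PKPiRecorded …` and every other byte of `pkPi_of_rung4` are UNCHANGED (B-p14 (g27) head probe
1fc5a7f9081359e5: rc 0, head axioms [propext, Classical.choice, Quot.sound]); (ii) `def StubD7αMemDock` = ONE joint print-derived ∃-statement per frame `(L ι H T hT hdef h2 μω hμu hμω)`: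
there exist record data `(Δ mH mG νG νH ξloc μZ) (hHaar) (keys) (hCM)` of ★ `F0P3XiPacketFamilyOfRecord.xiPacketFamilyOfRecord` such that (DOCK) every `(e₁ dV hdV hdV0 g hg) (ξ)` satisfies ★
`CMThetaDockingClauses …` [Rogawski1990 §13.1 Prop. 13.1.4; GelbartRogawski1991 Lem. 5.1.2] and (MEM) every constituent at a non-split `v` of a holomorphic∕antiholomorphic discrete
`σ` with `MemXiFamily P hH hHd μω hμu ξ` lies in `(xiPacketFamilyOfRecord … ξ v).members` [Rogawski1990 Thm. 13.3.7] — ONE stub because DOCK and `hCM` must share the bound data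
(ref1 r179 N1: junk-resistant); (iii) `theorem stub_RIGfDict : StubRIGfDict` PROVED (no `sorry`): borel σ-algebras, `obtain` the record data from `stub_D7αMemDock`, then ★ ISO-BRIDGE
p830228 `F0P2oIsoAtXfOfThetaTypeAt.exists_isoAtXfCM_of_forall_mem` (A-p12 (g17)) over ★ p830189 `F0P2oD7alphaMembersThetaClass.d7alpha_members_thetaClass` (B-p14 (g27)) fed with
#75-loc `xiLocalPacket_nonsplit_isThetaPair_of_stubs` := ★ twin p829745 `F0P2oXiLocalPacketThetaPairOfLetters.xiLocalPacket_nonsplit_isThetaPair_of_letters stub_N3_letter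
stub_K1w_letter stub_U1_letter stub_N6_letter stub_LABEL` (the same composition as the registered sub-line `Cruxes/H413/Lines/F0_P2XiLocalPacketThetaPair.lean` 46d3563480ea, by NAME
over the `Theorems/` twin — no `Cruxes/…/Lines` import, O50-1); `IsoAtXf` (this file) and ★ `IsoAtXfCM` agree definitionally.  New `sorry`s over ★-typed named facts: `stub_N6_letter`
[GetzHahn2024 Thm. 8.3.3; Rogawski1990 §12.2 p. 173; BernsteinZelevinsky1976 Thm. 3.21] (★ p826085; in-house: ⇒ ★ p829792 all non-split `v`, ⇐ ★ p830400 unramified non-split `v`,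
⇐ ramified = road (δ) B-p17 (g21)∕A-p16 (g23) live) and `stub_LABEL` (ENGINE: «the theta type of an occurring class is not square-integrable modulo the centre», the twin's `hL`
binder VERBATIM; folds to B-p18 (g28)'s `thetaType_not_squareIntegrable (hN3) (hN7)` over the N7 letter ★ `u3_squareIntegrable_jacquetExponent_decay`).  REGISTERED SORRY SET v1.7 =
{`stub_S2sharp` (S2♯, P3), `stub_N3_letter` (#96), `stub_K1w_letter` (#98), `stub_U1_letter` (#97), `stub_N6_letter` (N6), `stub_LABEL` (ENGINE → N7), `stub_D7αMemDock` (MEM+DOCK,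
print-derived)} — PRINT∕print-derived 6 ∕ ENGINE 1.  `PKPiTarget`, `IsoAt`, `IsoAtXf`, `ThetaTypeAt`, `GRDMatrix`, `StubGRD`, `StubRIGinf`, `StubRIGf` (now unregistered history),
`C2SharpLetter`, §4 and the head's conclusion are BYTE-IDENTICAL to v1.5.  HC_CM is proved only modulo the printed citations until rung 0 closes.

EDITION v1.8 «N6 FOLD» (F0P2-plan (g8), 2026-08-31).  `stub_N6_letter` is ★ CLOSED BY NAME over `Rogawski1990.u3_isSupercuspidal_iff_jacquet_eq_zero_holds` (p831380
`U3JacquetVanishingSupercuspidal`, A-p16 (g23): ⇒ ★ p829792; ⇐ ★ p830400 unramified + ★ p830719 ray Jacquet criterion over B-p17 (g21)'s elementary Cartan decomposition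
`UnitaryGroup.exists_cartan_of_involution` ★ p831121 for ANY involution, ramified and dyadic places included) — the same one-token fold as the registered sub-line
`Cruxes/H413/Lines/F0_P2XiLocalPacketThetaPair.lean` v1.1.  REGISTERED SORRY SET v1.8 = {`stub_S2sharp` (S2♯, P3), `stub_N3_letter` (#96), `stub_K1w_letter` (#98),
`stub_U1_letter` (#97), `stub_LABEL` (ENGINE → N7), `stub_D7αMemDock` (MEM+DOCK, print-derived; MEM = [Rogawski1990 Thm. 13.3.6 (c) p. 201 at `v = ι` + Prop. 15.2.1 (b);
Thm. 13.3.7], ref1 r181 N181-2)} — PRINT∕print-derived 5 ∕ ENGINE 1; every other byte = v1.7.  HC_CM is proved only modulo the printed citations until rung 0 closes.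

EDITION v1.9 «LABEL FOLD» (F0P2-plan (g8), 2026-08-31).  `stub_LABEL` (ENGINE) is ★ CLOSED BY NAME over p831648 B-p18 (g28)
`F0P2oThetaTypeNotL2.thetaType_not_squareIntegrable (hN3) (hN6) (hN7)` (conclusion = the stub token for token, 1726 = 1726, ref1 r184) fed `stub_N3_letter stub_N6_letter stub_N7_letter`;
the new PRINT stub `stub_N7_letter : Rogawski1990.u3_squareIntegrable_jacquetExponent_decay` [Casselman1995 Thm. 4.4.6 (⇒), as restated in KatoTakano2009 p. 3; Rogawski1990
§12.2 (2) pp. 173–174] (row N7, ★-typed typ-T7b (g0)) enters — the same fold as the registered sub-line `Cruxes/H413/Lines/F0_P2XiLocalPacketThetaPair.lean` v1.2.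
REGISTERED SORRY SET v1.9 = {`stub_S2sharp` (S2♯, P3), `stub_N3_letter` (#96), `stub_K1w_letter` (#98), `stub_U1_letter` (#97), `stub_N7_letter` (N7), `stub_D7αMemDock`
(MEM+DOCK, print-derived)} — PRINT∕print-derived 6 ∕ ENGINE 0; every other byte = v1.8.  HC_CM is proved only modulo the printed citations until rung 0 closes.

EDITION v1.10 «N6 + LABEL + K1w + U1 FOLD» (F0P2-plan (g8), 2026-08-31; director s662; ref1 r186∕r187).  The tree goes v1.7 → v1.10 in ONE write: the EDITION v1.8∕v1.9
paragraphs above describe boxed pre-writes that were folded into this one and never written.  NEW at v1.10: `stub_K1w_letter` is ★ CLOSED BY NAME over p832032 F0P2-p06 (g0)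
`F0P2pK1wLetterOfN1.cmPrincipalSeries_isConstituentOf_weylConj_of_N1 (hN1)` fed the NEW print stub `stub_N1_letter : ∀ L …, UnitaryGroup.U3PrincipalSeriesJacquetFiltration L`
[Casselman1995 Lemma 7.1.1 (a) p. 67, Thm. 6.3.5 p. 59; BernsteinZelevinsky1977 §2.12, Cor. 2.13 (c); Rogawski1990 §12.2 p. 173] (row #107, ★-typed typ-T3a; = the K1w∕CM-head
hypothesis token for token); `stub_U1_letter` is ★ CLOSED BY NAME over ★ p829230 `F0P2oU1LetterOfTower.u1ThetaDichotomy_nonsplit_of_uniqueSub stub_N3_letter (h4)` with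
‹h4› := ★ p832406 B-p18 (g28) `F0P2pPrincipalSeriesUniqueSubCM.principalSeries_uniqueSub stub_N1_letter` (CM head; ★ p831178 F0P2-p02 (g6) generic + ★ p831282 N1 unfold) — the same fold as the registered sub-line `Cruxes/H413/Lines/F0_P2XiLocalPacketThetaPair.lean` v1.3.
REGISTERED SORRY SET v1.10 = {`stub_S2sharp` (S2♯, P3), `stub_N3_letter` (#96), `stub_N1_letter` (#107), `stub_N7_letter` (#110), `stub_D7αMemDock` (MEM+DOCK, print-derived)} — PRINT∕print-derived 5 ∕ ENGINE 0; all statements and every other byte = v1.9 text.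
HC_CM is proved only modulo the printed citations until rung 0 closes.

EDITION v1.11 «N1 DROP + HOLDS FOLD» (F0P2-plan (g8); proof-only, count-neutral except as noted).  `stub_N1_letter` (#107, ★ CLOSED on the P3b side p832625) is DELETED — no consumer is left: `stub_K1w_letter := ★ p833012 F0P2-p06 (g2) `F0P2pK1wHolds.cmPrincipalSeries_isConstituentOf_weylConj_holds`
(HYPOTHESIS-FREE K1w) and `stub_U1_letter := ★ p833094 F0P2-p06 (g2) `F0P2pGR91NOfN3.u1ThetaDichotomy_nonsplit_of_N3 stub_N3_letter` (U1 modulo N3 only; inside: ★ p829230 tower ∘ ★ p832559 CM head ∘ ★ p832625 N1); `stub_GR91N := ★ p833094 `F0P2pGR91NOfN3.GR91Lemma512NonsplitAsPrinted_of_N3 stub_N3_letter` (#76 modulo N3 only).  Imports: − the four v1.3-fold modules (now reached transitively through ★ p833094), + ★ p833012, + ★ p833094.  REGISTERED SORRY SET v1.11 = {`stub_S2sharp` (S2♯, P3), `stub_N3_letter` (#96), `stub_N7_letter` (#110), `stub_D7αMemDock` (MEM+DOCK, print-derived)}; every statement and the head are BYTE-IDENTICAL to the previous edition.  HC_CM is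 proved only modulo the printed citations until rung 0 closes.

EDITION v1.12 «N3 SPLIT + N3D FOLD + N7 FOLD» (desk F0P2-plan (g8), 2026-08-31T22Z; director s705 DENOMINATION: #96 N3 stays ONE books row, re-denominated BY NAME to the packager՚s open print inputs; proof-only for every existing statement, heads byte-unchanged; supersedes v1.11 4acab29940a0).  `stub_N3_letter` [GelbartRogawski1991 §3.2 (3.2.1)–(3.2.2) p. 457; Kudla1986 Thm. 2.8] is ★ CLOSED BY NAME over F0P2-p06 (g3)՚s
★ p835661 `F0P2oN3OfTorusWeight.thetaType_nonsplit_jacquetModule_of_a_of_torusWeight stub_N3a_letter stub_N3D_letter` (packager over the ★ p835430 (b)-assembler `F0P2oN3TorusWeightOfD3d`: clause (b) of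
the letter — the `m(γ)`-weight on `r_N(X_v)` read through the (D3d) undoubling∕coinvariant bricks ★ p834000 · p834249 · p835415 · p835416 · p835417 · p835587 · p835588 · p835613 (A-p16 (g24)) — is PROVED modulo
(hD); clause (a) is (hA)).  TWO NEW PRINT-RESIDUE STUBS, typed TOKEN FOR TOKEN as the packager՚s binders (extracted by script from the TREE bytes dc6083d4a23e6b99 of the ★ file, lines :83–:100 ∕ :101–:117,
under its `open` ∕ `set_option` context via `set_option … in open … in`; the fold line elaborating is the fidelity certificate): `stub_N3a_letter` = clause (a) «`r_N(X_v(μ, ε, χ_f)) ≃ ℱ_v[ψθ]` as a `C`-line: the Borel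
coinvariants of `X_v` are the `ψθ ∘ det`-weight space of the rank-one line Weil representation» [GelbartRogawski1991 §3.2 (3.2.1) p. 457; Kudla1986 Thm. 2.8 (top filtration piece = ev₀)] (in-house road, lead B-p18 (g29):
(S4) ★ p834408 ∘ CM closer ★ p832817 ∘ chart sockets ★ p834949∕p835111 (A-p12 (g17)) ∘ F0P2-p01 (g8)՚s (E1) ★ p835408 ∕ (E2) ∕ (E3) ★ p835407 ∕ (N) ∕ (W) dictionary; B-p18 (g29) 22:04:27Z rows (LS) local see-saw + (FN) frame
naturality; B-p10 (g22) (1b) ★ p835647) and `stub_N3D_letter` = the torus weight «`m(γ)` acts on `r_N(X_v)` by `μ_w(γ)‖γ‖_w^{1/2}`» [Kudla1986 Thm. 2.8; Rogawski1990 §12.2 (2) p. 174] (in-house: A-p16 (g24)՚s (5b) CM-package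
wrapper `Theorems/F0P2oThetaJacquetTorusWeight.lean` over ★ p835613 (5a) ⇒ ★ `F0P2oN3TorusWeightOfD3d.thetaType_nonsplit_jacquetModule_b_of_kerWeight`, ★ p835944; and (5c) ★ p836093 `F0P2oN3TorusWeightHolds.forall_jacquetModule_xThetaGqsCM_torus_eq_smul` PROVES the (hD) binder token for token ⇒ `stub_N3D_letter` is ★ CLOSED BY NAME in this edition — #96 N3 hinges on clause (a) ALONE).  «N7 FOLD» in the same write: `stub_N7_letter` [Casselman1995 Thm. 4.4.6 (⇒); Rogawski1990 §12.2 (2) pp. 173–174] := ★ p835805 A-p13 (g27) `F0P2oN7OfCasselmanCriterion.u3_squareIntegrable_jacquetExponent_decay_holds` (HYPOTHESIS-FREE over #109 N5 ★ p834912 `F0P3U3SquareIntegrableExponentsHolds`; by-import tie GREEN A-p13 22:38:00Z) — books #110 N7 UNPROVED −1 at this REGISTERED edition (director՚s fold).  Sorry set of this file after v1.12: {`stub_S2sharp`, `stub_N3a_letter`, `stub_D7αMemDock`} — PRINT 1 (clause (a) of #96) ∕ ENGINE 2 (unchanged hands).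
HC_CM is proved only modulo the printed citations until rung 0 closes.

EDITION v1.16 «DOCK-TW1» (heir desk F0P3-plan (g14) D63 PRICE 2026-09-02T05:10:54Z; LEAD F0P3a-plan (g13) T12-28 (1) «v1.16 W1 GO» 05:08:26Z; F0P2-ref1 (g10) r363∕r364∕r365∕r367∕r369; LH10-p02 (g0) architectural finding 03:19:42Z + F0P2-p06 (g14) census 03:24:26Z; pen F0P2-p06 (g14); generated by script from the TREE bytes of v1.15 1c411f575d01a948 with count==1 anchors): the D7α node is RESTRICTED TO THE WEIGHT-ONE AUTOMORPHIC LOCUS — `theorem stub_D7αMemDockμTW1 : Summit.HodgeConjecture.HodgeConjecture.Cruxes.H413.F0P2oD7alphaMemDockStatementW1.StubD7αMemDockPerMeasureTW1 := by sorry` (★ p849450: ★ node ED. 2 text with the DOCKᵀ conjunct ↦ ★ p848882 `Rogawski1990.CMThetaDockingClausesTestW1` = ★ `CMThetaDockingClausesTest` with `HasWeight L μ 1 → IsAutomorphicOneChar (↥(maximalRealSubfield L)) L (IsCMField.complexConj L) χf →` inserted after the unit-norm hypothesis; SHAPE∕MEM byte-identical).  CHANGED-STATEMENT exactly {the node token `stub_D7αMemDockμT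 : …StubD7αMemDockPerMeasureT` ↦ `stub_D7αMemDockμTW1 : …StubD7αMemDockPerMeasureTW1`; `def StubRIGfDict` gains ONE binder line `HasWeight L μ1 1 → IsAutomorphicOneChar (↥(maximalRealSubfield L)) L (IsCMField.complexConj L) χf →` after its unit-norm hypothesis — NEEDED, not dischargeable inside `stub_RIGfDict`: that stub quantifies over an ARBITRARY DICT-tied pair `(μ1, χf)` (no weight∕automorphy in scope), and its proof must hand the two facts to the W1 dock (★ p849454 `d7alpha_packet_members_thetaClassTestW1 … hcont hunit hw haut …`); the head `pkPi_of_rung4` applies `hRIGf` ONLY at the GRD witness `(grdMu ξ, grdChi ξ)` where `hw : HasWeight … 1`, `haut : IsAutomorphicOneChar …` are in scope from ★ `F0P2iRIGinfDischarge.rigInf_node_of_xiArchPinned` (:923) and now passes them (:941)}; REMOVED {`stub_D7αMemDockμT`}; ADDED {`stub_D7αMemDockμTW1`, the sorry-free MONOTONICITY probe `stubD7αMemDockPerMeasureTW1_of_T : …PerMeasureT → …PerMeasureTW1` (★ `stubD7αMemDockPerMeasureT_toW1`) certifying «v1.16 only WEAKENS the node»}; CHANGED-BODY-ONLY {`stub_RIGfDict`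 (intro `hw haut`, glue ↦ ★ W1 glue), `pkPi_of_rung4` (`… hcont hunit hw haut …` at the `hRIGf` application)}; every other def∕letter∕head (`PKPiTarget`, `PKPiRecorded`, `pkPi_of_rung4`՚s statement, `stubPKPi_of_rung4_stubs`, `StubD7αMemDock`, `stubD7αMemDockPerMeasure_of_uniform`, §4) byte-unchanged; +2 imports (★ p849450, ★ p849454).  WHY (fidelity + payability): the dock ∕ (D-b) letters are consumed ONLY on Liu՚s weight-one automorphic locus (census: Theorems ★ `d7alpha_packet_members_thetaClassTest` :143 fed from ★ `pkPi_of_tokens` :208–:221; skeleton :897 → :936), so the W1 letters are print՚s letters [Rogawski1990 Prop. 13.1.3 (d), 13.1.4; GelbartRogawski1991 Lem. 5.1.2, Thm. 5.1.1] RESTRICTED to that locus (weaker, ★ `_toW1` one-liners), and on that locus LH10 pays (D-b)ᵀˢ-W1 IN-HOUSE (leaf `F0_P3c_DbTPaydown.lean` ED. 5-W: O1-W1 ★-closed by ★ p848642 over Θ-OCC-GEN; residue O2♭ [Rogawski1990 Thm. 13.3.6 (c)] print) — the GR91 §5 global-theta dependency leaves the h413 cone.  DISCHARGE ROAD (LEAD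 T12-28 (w-c), Day-X recipe amended): `stub_D7αMemDockμTW1 := F0P2oD7alphaMemDockOfRowsSCDSignedW1.stubD7αMemDockPerMeasureTW1_of_rowsSCDSigned frameDataOfRung0 rows_of_rung0 ⟨𝔨.Δ, mH, mG, νG, νH, μZ, isHaar_μZ, isHaar_νG, keys, hQS, rfl, hex, fun e₁ dV hdV hdV0 g hg ξ => Db_T_paidW1 …⟩` (★ p849516 over ★ B2-W1 p849502, ★ B1 sign transport p848284∕p848876, LH7 ★ `formSignAt` p848301; road-S fallback ★ p848524 + `Db_T_paid` + the probe above); Lines-free Day-X twin ★ p849503 `F0P2vPKPiOfTokensW1.pkPi_of_tokensW1 (h80) (hD7αTW1)`.  Sorry set of this file after v1.16: {`stub_S2sharp` (#80, P3 hand), `stub_D7αMemDockμTW1`} = 2 (non-increasing).  HC_CM is proved only modulo the printed citations until rung 0 closes.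

EDITION v1.15 «DOCK-T» (desk F0P2-plan (g9), 2026-09-01; T8-21 «Q-CM junk» director s758∕s759; desk ruling 02:57Z on F0P2-p01 (g9)՚s node ED. 2 «PACKET-LEVEL, R4-FREE»): the D7α per-measure node is RE-TYPED ON TEST FUNCTIONS and CUT TO ITS CONSUMER — `theorem stub_D7αMemDockμT : Summit.HodgeConjecture.HodgeConjecture.Cruxes.H413.F0P2oD7alphaMemDockStatement.StubD7αMemDockPerMeasureT := by sorry` (★ p840486 ED. 2 of `Theorems/F0P2oD7alphaMemDockStatement.lean`: `∀ frame μ, ∃ (Δ mH mG νG νH ξloc μZ) (packFin) (_hHaar) (_hνG), DOCKᵀ ∧ SHAPE ∧ MEM_μ` — DOCKᵀ = ★ p840296 `Rogawski1990.CMThetaDockingClausesTest` (the (13.1.4) identity on TEST functions, ★ R1 `CharIdentityOnTestFunctions`), SHAPE = the non-split packet shape `⟨πⁿ∘e, some πˢ⟩` with Keys labels, `L²` flags and a Test-(13.1.4) completion `πˢ` (binder block of ★ p840385), MEM_μ over the abstract `packFin`); CHANGED-STATEMENT exactly {the node token՚s type: `…StubD7αMemDockPerMeasure` (v1.14; DOCK∕`hCM`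 halves vacuous-holed as typed, ★ p840179 `F0P2oDockJunkInheritance`) ↦ `…StubD7αMemDockPerMeasureT`}; REMOVED {`stub_D7αMemDockμ`}; ADDED {`stub_D7αMemDockμT`}; CHANGED-BODY-ONLY {`stub_RIGfDict`: lambda 2 of ★ `exists_isoAtXfCM_of_forall_mem` now by ★ p840385 `F0P2oD7alphaMembersThetaClassTest.d7alpha_packet_members_thetaClassTest` at the SHAPE witnesses}; `def StubD7αMemDock`, `stubD7αMemDockPerMeasure_of_uniform`, every head and every letter byte-unchanged; +1 import (glueᵀ).  DISCHARGE ROAD: producerᵀ `F0P2oD7alphaMemDockOfRows` ED. 2 `…_of_rowsT` (F0P2-p01 (g9); `packFin := (kitFamilyOfRecord 𝔇 …).packFin`, MEM ★ p839806, DOCKᵀ ⟸ ★ p840326 junction ⟸ (D-b)ᵀ ★ p840297 `piSCompletion_isThetaTypeAtCMTest` + `hex`) instantiated closer-side with `stub_DbT` ((D-b)ᵀ, PRINT, +1 fan-B row at that consumption — director s757∕s759 (2); NEVER `stub_Db` as typed) once the H₇ plumbing rides a T1-API∕closer edition.  Sorry set of this file after v1.15: {`stub_S2sharp` (#80, P3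 hand), `stub_D7αMemDockμT`}.  HC_CM is proved only modulo the printed citations until rung 0 closes.

EDITION v1.14 «D7α RE-CUT BY NAME» (desk F0P2-plan (g9), 2026-09-01; desk ruling on SPEC (D7α-J) 7018008cb4df3907 of F0P2-p01 (g9) ∕ F0P2-p02 (g8)): the D7α node is RE-CUT PER MEASURE and carried BY NAME — `theorem stub_D7αMemDockμ : Summit.HodgeConjecture.HodgeConjecture.Cruxes.H413.F0P2oD7alphaMemDockStatement.StubD7αMemDockPerMeasure := by sorry` (statement = `∀ frame, ∀ μ [IsAutomorphicMeasure μ], ∃ (Δ mH mG νG νH ξloc μZ keys hCM) (_hHaar), DOCK ∧ MEM_μ`: the v1.13 body with EXACTLY the `∀ (μ …) […]` binder of the MEM conjunct moved to the prefix, desk bytes `F0/P2/d7a/StubD7aMemDockPerMeasure.body` sha16 24deb9c9670f5d47 = ★ p839951 `Theorems/F0P2oD7alphaMemDockStatement.lean`); it is WEAKER than the v1.13 registered statement (∃∀ ⇒ ∀∃), certified in this file by the sorry-free `theorem stubD7αMemDockPerMeasure_of_uniform : StubD7αMemDock → …` (`def StubD7αMemDock` is KEPT as the settled v1.13 text); the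 v1.13 registered `sorry` `theorem stub_D7αMemDock` is REMOVED; its one consumer `stub_RIGfDict` is re-proved over `stub_D7αMemDockμ … μ` (proof-only; `μ` is in scope at the `obtain`).  WHY: the ∃-data of record (Δ, mH, mG, hQ) are outputs of the T1 engine (`Cruxes/H413/Lines/F0_T1InnerFormTraceIdentity*`, chosen PER μ by the closer՚s `rung0Choice`), so (i) no Lines-free file maps letters BY NAME to them (O50-1 stands: no `Cruxes∕…∕Lines` import here), (ii) the per-measure form is what both the producer and the only consumer use.  ROADS (deal (D7α-J)): ★ p839806 F0P2-p01 (g9) `F0P2oD7alphaMemOfT5` (MEM, kit-generic) + ★ p839791 F0P2-p02 (g8) `F0P2oCharIdentityCompletionUnique` (DOCK ⟸ theta witness (D-b) + surjective matching) → brick `Theorems/F0P2oD7alphaMemDockOfRows.lean :: stubD7αMemDockPerMeasure_of_rows (H₁…H₈) : StubD7αMemDockPerMeasure` (Lines-free, assembly only; H₈ = the ONE new print letter (D-b) `GelbartRogawski1991.piSCompletion_isThetaTypeAtCM` [GelbartRogawski1991 Lem. 5.1.2 + Thm. 5.1.1; Rogawski1992 Thm. 1.1; Rogawski1990 Prop.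 13.1.3 (d)], B-p18 (g29) typing) → closer-side discharge `…_of_rows (frameDataOfRung0 …) (rows_of_rung0 …) …` (F0P3 pen).  Sorry set of this file after v1.14: {`stub_S2sharp` (#80, P3 hand), `stub_D7αMemDockμ` (per-measure node BY NAME: discharged in the tree wherever `rung0Choice` is visible; here an O50-1 junction residue + print (D-b))}.  HC_CM is proved only modulo the printed citations until rung 0 closes.

EDITION v1.13 «N3 DIRECT FOLD» (desk F0P2-plan (g9), 2026-09-01; proof-only for every SURVIVING statement, every surviving statement and head byte-unchanged; the clause-(a) stub `stub_N3a_letter` of v1.12 is DROPPED (N1-DROP precedent: its only consumer was the body of `stub_N3_letter`); supersedes v1.12 29b92eba80d3).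
The N3 letter #96 [GelbartRogawski1991 §3.2 (3.2.1)–(3.2.2) p. 457; Kudla1986 Thm. 2.8] `GelbartRogawski1991.thetaType_nonsplit_jacquetModule` — the LAST local print letter of programme P2 below the packet letters — is ★ CLOSED BY NAME, HYPOTHESIS-FREE, by the η-free (N′) line-Jacquet road:
`stub_N3_letter := Summit.HodgeConjecture.HodgeConjecture.Cruxes.H413.F0P2oLineJacquetHolds.thetaType_nonsplit_jacquetModule_holds`
(★ p839151 F0P2-p06 (g4) `Theorems/F0P2oLineJacquetHolds.lean :: thetaType_nonsplit_jacquetModule_holds` (the (JA) junction over ★ (C5) p838835 B-p10 (g23), ★ (C6)∕(J1)–(J4) p838314 B-p14 (g29) + `F0P2oLineJacquetReindex`, ★ (BE) p838099∕p838184 B-p18 (g29), ★ (N′) p837961 F0P2-p06 (g4), ★ (LS) p836839, ★ (LM) p836568, ★ (FX)(CC) p837171∕p837965, ★ (BF) p837182, ★ (BD) p838316, ★ (IB) p838392, ★ (KL) p838305, ★ (SJ-gen) p838357; lead B-p18 (g29) socket (B) word 2026-08-31T23:47:37Z); conclusion = the Literature named fact BY NAME; the fold line elaborating is the certificate).  +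 import ★ `Theorems.F0P2oLineJacquetHolds`.  Sorry set of this file after v1.13: {`stub_S2sharp` (#80, P3 hand), `stub_D7αMemDock` (ENGINE)} — PRINT 0 ∕ ENGINE 1 + the P3 import S2♯: every LOCAL letter of rung 4 (`stub_N3_letter`, `stub_U1_letter`, `stub_GR91N` #76, `stub_LABEL`, `xiLocalPacket_nonsplit_isThetaPair_of_stubs` #75-loc) is closed HYPOTHESIS-FREE; the engine hands are unchanged.  BOOKS: #96 N3 closes on the HYPOTHESIS-FREE Theorems-level proof of `GelbartRogawski1991.thetaType_nonsplit_jacquetModule` (director՚s pen, s527 criterion (i)); this edition is the consumer catch-up BY NAME.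
HC_CM is proved only modulo the printed citations until rung 0 closes.

THE RE-CUT (all statements by paste over tree vocabulary; no `Cruxes/…/Lines` import, O50-1):
* §0 `PKPiTarget` — PKΠ VERBATIM (token-identical to `F0P2PKRung3.StubPKPiPlacewiseMembership`; `IsoAt` VERBATIM, bridges `isoAt_iff`, `isoAt_chi_mk` by `Iff.rfl`).
* §1 the vocabulary of the cut: `IsoAtXf` (= `IsoAt` with the automorphic `χ : Chi` replaced by a PLAIN character `χf` of `U(1)(𝔸_{L⁺,f})`, so that
  automorphy is a separate, archimedean clause), `ThetaTypeAt … μ hμ χf ε v c` («every smooth representation of `U(H)(L⁺_v)` isotypic for the class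
  `c ∈ Irr(U(H)(L⁺_v))` (read through ★ `localPiEquiv v`) is `X_v(μ,ε,χf) ∘ κ_v⁻¹`-isotypic» — the class-to-isotypy transport is INSIDE the predicate, so the
  head never manipulates `isotypicComponent`), and `GRDMatrix … ξ μω hμu μ hμ χf` — THE FINITE GELBART–ROGAWSKI DICTIONARY as a PREDICATE on a pair `(μ, χf)`:
  (S) at every place `v` SPLIT in `L`, every member of every ξ-local family (★ `IsXiLocalFamily`: there it IS the singleton ★ `cmSplitPacket` =
  `{i_G(ξ_w ⊗ μ_w∘det₀)}` [Rogawski1990 Lemma 4.13.1 (b)]) is a `(μ,χf)`-theta type of SOME line class; (N) at every NON-SPLIT `v` and every form congruence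
  `ᵗT̄·H_v·T = a·Φ₃` (the D6 binders verbatim), SOME constituent `x₀` of the principal series `i_G(χ_ξ)` (★ `cmPrincipalSeries`∕`cmXiTorusChar`, i.e.
  `x₀ ∈ JH(i_G(χ_ξ)) = {πⁿ(ξ_v), π²(ξ_v)}` [§12.2 (2)]) transported along ★ `cmDatumLocalCongr` is a `(μ,χf)`-theta type of SOME line class — in print `x₀ = πⁿ(ξ_v)`,
  «the non-tempered member of `Π(ξ_v)` is the Weil-representation lift of a character of `U(1)`» [GelbartRogawski1991 §5.1 (5.1.1), Lemma 5.1.2 p. 466;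
  Haan arXiv:1501.00885 Thm. 3.4 (ii): WHICH line class carries the non-tempered lift is decided by a local root number, hence `∃ ε`, never `ε = 1`].
  NO Haar measure, no `π²`∕`πˢ` label, no L-parameter is named: the π²-slot and the supercuspidal slot of the envelope are the ENGINE's business (RIGf).
* LTY — LOCAL TYPES — is ★ BY NAME, not a stub: ★ CL `F0P2cStubCLLocalTypeExists.stubCL_holds` (rung 2: an irreducible admissible `σ` of `U(H)(𝔸_{L⁺,f})` is,
  at each `v`, isotypic for an irreducible `τ_v` [FlathCorvallis1979 Thm. 2]) and ★ p816375 `F0P2hLTYLocalConstituents.exists_member_isConstituentOf_localType`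
  (F0P2-p01 (g5): in a ξ-envelope, some member `c ∈ Pv v` is carried by `τ_v`) are applied in the head.
* §1 the four statements: `StubGRD` (LOCAL ∃, class U′-print∕L:
  for every `ξ`, `μω` there is a pair `(μ₀, χf)`, `χf` continuous, such that EVERY conjugate-symplectic `μ` with the same semi-local components as `μ₀` at all
  finite places satisfies `GRDMatrix` — the dictionary `ξ = (η,ψ) ↦ (μ_ξ, χ_ξ)` of [GelbartRogawski1991 (5.1.1)] ∕ [Rogawski1990 §13.3 p. 195: `φ = μ η̃`] is
  PRODUCED BY THE PROVER, no sign convention is typed here (dead line «μOf by formula»)); `StubRIGinf` (ENGINE, archimedean∕global, class U: for a COTANGENT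
  discrete `P` in the ξ-envelope and any pair satisfying the finite dictionary, ∃ `μ1` conjugate-symplectic of WEIGHT ONE with the same finite semi-local
  components, and `χf` is automorphic (`∈ Chi`: trivial on `L¹`) — [Rogawski1990 Prop. 12.3.3, Prop. 15.2.1 (b), Thm. 13.3.6 (c)]: `P_ι = πⁿ(ξ_ι) ∈ {J^±}` pins `ξ_∞`
  of cohomological type, whence `μ_ξ` has weight one [Liu2021 Lem. (le:weil_arch), Prop. 4.13 Case 1] and the centre `Z(L⊗ℝ) ⊂ K_∞` acts trivially on the
  cotangent `K`-type, so the central character `χf = ω_{P,f}` is automorphic; the finite matrix PINS `(μ_f, χf)` (continuity + density of `⊕_v U(H)(L⁺_v)`), which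
  is why the `∀`-form is true — a bare «finite matrix ⇒ weight one» is FALSE (twists `μ ↦ μ·ν̃`, `ν_f = 1`, shift the ∞-type), hence the `∃ μ1` shape);
  `StubRIGf` (ENGINE, finite non-split, class U: for cotangent `P` in the ξ-envelope with finite component `σ` and a pair satisfying the finite dictionary, at every
  NON-SPLIT `v` some line class makes `σ ∘ inclPlace v` `X_v(μ,ε,χf)∘κ_v⁻¹`-isotypic — in print: the local type of `σ` at `v` lies in Rogawski's `Π(ξ_v) =
  {πⁿ(ξ_v), πˢ(ξ_v)}` [Thm. 13.3.6 (c), Thm. 13.3.7, Prop. 13.1.3 (d), 13.1.4: NOT the square-integrable `π²(ξ_v) ∈ ξ_H(St_H(ξ))`, and the supercuspidal member is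
  pinned by the character identities], `πⁿ(ξ_v)` is the (N)-slot of the dictionary and `πˢ(ξ_v) = Θ_{V⁻}(χ)` is the theta type of the OTHER line class
  [GelbartRogawski1991 Prop. 5.2.2; GelbartRogawskiSoudry1997 Prop. 2.5.1 (b); Haan Thm. 3.4 (ii)] — this is exactly P3's rigidity rows Z4∕Z5∕Z7 + the parked D7′
  (director s496 D-b) read in theta currency; it is the deep input and is labelled ENGINE honestly); and S2♭ BY NAME (★ named fact
  `Rogawski1990.cohDiscrete_memXiFamily`, shared with P3's `Lines/F0_U3LettersRung1.lean` ED.3 — debt-free rule s341: no new named fact is declared here).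
* §2 the three registered stubs (the ONLY `sorry`s, v1.4): `stub_S2sharp` (S2♯ placeholder∕letter), `stub_GR91N` (PRINT by name), `stub_D7α` (PRINT by name); `stub_RIGf` is PROVED from `stub_D7α` by the adapter `stubRIGf_of_D7α`; GRD and RIG∞ are discharged in the head.  v1.5: `stub_GR91N` is PROVED from the three letter stubs `stub_N3_letter`, `stub_K1w_letter`, `stub_U1_letter` by the ★ twin `GR91N_of_letters` — the `sorry`s are {`stub_S2sharp`, `stub_N3_letter`, `stub_K1w_letter`, `stub_U1_letter`, `stub_D7α`}.  v1.7: `stub_D7α`∕`stubRIGf_of_D7α`∕`stub_RIGf` are RETIRED; RIGf is re-cut on the DICTIONARY pair (`def StubRIGfDict`) and PROVED (`stub_RIGfDict`, no `sorry`) from ONE joint print-derived ∃-stub `stub_D7αMemDock : StubD7αMemDock` (record MEMBERSHIP + theta DOCKING at the record data) and #75-loc `xiLocalPacket_nonsplit_isThetaPair_of_stubs` (★ twin over `stub_N3_letter stub_K1w_letter stub_U1_letter stub_N6_letter stub_LABEL`) via ★ ISO-BRIDGE `exists_isoAtXfCM_of_forall_mem` ∘ ★ `d7alpha_members_thetaClass`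 — the `sorry`s are {`stub_S2sharp`, `stub_N3_letter`, `stub_K1w_letter`, `stub_U1_letter`, `stub_N6_letter`, `stub_LABEL`, `stub_D7αMemDock`}; the head hypothesis `(hRIGf : StubRIGf)` is re-typed `(hRIGf : StubRIGfDict)` (conclusion byte-identical).
* §3 THE HEAD `pkPi_of_rung4 : S2♭ → GRD → RIG∞ → RIGf → PKPiRecorded` (kernel-checked: ★ `exists_muOmega` gives Rogawski's `μω`; ★
  `exists_cohToken_of_isHolOrAntihol_cpt` turns «hol ∨ antihol cotangent» into the `(𝔤,K)`-cohomology token of S2♭; S2♭ gives `ξ` with `MemXiFamily P … ξ`; GRD gives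
  `(μ₀, χf)` and the matrix for every `μ` with `μ_f = μ₀,f`; RIG∞ gives `μ1` of weight one with `μ1,f = μ₀,f` and `χf ∈ Chi`; at a SPLIT `v`: ★ CL gives the
  local type `τ_v`, ★ LTY-c (p816375; = ★ T♭∕(b2′) + ★ D6 `LocalConstituentsIn`) a member of the family carried by `τ_v`, (S) makes `σ_v` a theta type; at a
  NON-SPLIT `v`: RIGf), and THE ONE CONCLUDER BY NAME `stubPKPi_of_rung4_stubs : PKPiTarget`.
* §4 (sorry-free) bookkeeping: `isoAt_iff`, `isoAt_chi_mk` (`IsoAt … ⟨χf, h⟩ … ↔ IsoAtXf … χf …`, `Iff.rfl`), `grdMatrix_split` (projection).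

CENSUS HONESTY.  Letters of PKΠ after this cut: {S2♭ (P3-owned, ★-named), RIG∞ (ENGINE-arch), RIGf (ENGINE-finite)} deep; {GRD (LOCAL print∕in-house L)}
shallow; LTY ★.  RIGf's conclusion is PKΠ's local clause RESTRICTED to non-split places and CONDITIONED on envelope membership and on the finite
dictionary — strictly weaker than PKΠ (no weight, no `Chi`, no split places, `ξ` and `(μ,χf)` given); RIG∞ carries no local isotypy at all.  Why it might
fail AS TYPED: (GRD-S) the identification of the split member `i_G(ξ_w ⊗ μ_w∘det₀)` with a type-II theta lift `GL₁ → GL₃` [Minguez2008 Thm. 1] at the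
tree's normalisations (`splitν₀`, `locψ`, `JW`, `chiLocalSplittingsD`); (GRD-N) the `‖·‖^{1/2}` in `χ_ξ` vs the oscillator normalisation; (RIG∞) only if the
finite matrix failed to pin `χf` (it does: `χf` continuous); (RIGf) the parked identity D7′ `πˢ(ξ_v) = Θ_{V⁻}` at ramified `v` (GRS97 covers it).

Dead lines avoided (gen 2–6 record): no `μOf ξ` by formula (sign conventions `η̃(a) = η(a/ā)`, Liu's `μ ↦ μ⁻¹` unverified); no `IsSquareIntegrable`
discriminator (Haar binders in the head; `μZ = 0` vacuity); no `∀`-form «finite matrix ⇒ weight one» (false); no `χf` without continuity (false automorphy);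
no one opaque DICT row at `Mem := MemXiFamily` (p01 N78-1 ∕ ref1 r78); no `πⁿ∕π²∕πˢ` packet terms (tree has no `πˢ`; D7 parked s496); no `Lines` import; no
`allowUnsafeReducibility`; no skeleton registration against the crux (s499: the registry of record stays `Lines/a3_liu413.lean`).

## References
* [Rogawski1990] J. Rogawski, Ann. of Math. Stud. 123 (1990): §4.13 Lemma 4.13.1 (b) p. 62; §12.2 (2) pp. 173–174; §12.3 Prop. 12.3.3 p. 178; §13.1 p. 199,
  Prop. 13.1.3 (d), 13.1.4; §13.3 pp. 195, 201–203 (Thm. 13.3.5, 13.3.6 (c), 13.3.7); §14.6 Thm. 14.6.4 p. 246; Prop. 15.2.1 pp. 249–251.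
* [GelbartRogawski1991] S. Gelbart, J. Rogawski, Invent. Math. 105 (1991): §5.1 (5.1.1), Lemma 5.1.2 p. 466; Prop. 5.2.2 p. 467.
* [GelbartRogawskiSoudry1997] S. Gelbart, J. Rogawski, D. Soudry, Ann. of Math. 145 (1997): Prop. 2.5.1 (b).
* [Haan2015] J. Haan, arXiv:1501.00885: Thm. 3.4 (ii) (ε-dichotomy for `U(1) × U(3)`).
* [Minguez2008] A. Mínguez, Ann. Sci. ÉNS 41 (2008): Thm. 1 (type II theta, split places).
* [Liu2021] Y. Liu, Camb. J. Math. 9 (2021) = arXiv:2102.11518: Def. 4.11–4.12, Prop. 4.13 (Case 1), Remark 4.14, Lem. (le:weil_arch).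
* [FlathCorvallis1979] D. Flath, PSPM 33.1 (1979) Thm. 2, Thm. 3; [Bump1997] Prop. 3.4.2; [BourbakiAlgebreVIII2012] VIII §4 n°2.
-/

set_option autoImplicit false

-- paste discipline: this file re-declares rung-3 names (`IsoAt`) in its own namespace
set_option linter.dupNamespace false

noncomputable section

open NumberField MeasureTheory IsDedekindDomain
open scoped Matrix ComplexOrder

namespace Summit.HodgeConjecture.HodgeConjecture.Cruxes.H413.F0P2PKPiRung4

open Literature.NumberTheory Literature.NumberTheory.Automorphic Literature.NumberTheory.Automorphic.UnitaryGroup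
open Literature.NumberTheory.Automorphic.UnitaryGroup.CotangentForms
open Literature.NumberTheory.Automorphic.IdeleClassGroup
open Literature.NumberTheory.Automorphic.Liu2021 Literature.NumberTheory.Automorphic.Liu2021.Def411WeilCarriers
open Literature.NumberTheory.Automorphic.Liu2021.Def411WeilCarriersDoubling
open Literature.NumberTheory.GelbartRogawski1991 Literature.NumberTheory.GelbartRogawski1991.UnitaryDualPair
open Literature.NumberTheory.GelbartRogawski1991.UnitaryDualPair.WeilCoinv
open Literature.RepresentationTheory Literature.RepresentationTheory.Liu2021
open Literature.NumberTheory.GaloisRepresentations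
open Literature.NumberTheory.Rogawski1990
open Summit.HodgeConjecture.CorCM.Transposition
open Summit.HodgeConjecture.HodgeConjecture.Cruxes.H413.F0P3MemXiFamilyTransfer
open Summit.HodgeConjecture.HodgeConjecture.Cruxes.H413.F0P3SLayerFoldShapes
open Summit.HodgeConjecture.HodgeConjecture.Cruxes.H413.F0P2cStubCLLocalTypeExists
open Summit.HodgeConjecture.HodgeConjecture.Cruxes.H413.F0P2hLTYLocalConstituents
open Literature.RepresentationTheory.KonnoKonno2007 Literature.RepresentationTheory.BorelWallach2000   -- v1.4: `uFormGroup`, `upqTypeClasses` in `C2SharpLetter`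

attribute [local instance 100] LieRing.ofAssociativeRing   -- v1.4: `LieRing (Module.End ℂ M)` for the `σ𝔤` binder of `C2SharpLetter` (as ★ `GlobalAPacketLetters` :37, ★ `F0P3SLayerFoldShapes` :42)

/-! ## §0 The target: PKΠ VERBATIM (token-identical to `F0P2PKRung3.StubPKPiPlacewiseMembership`, the one live `sorry` of `Lines/F0_P2PKRung3.lean` v1.2 :323) -/

set_option synthInstance.maxHeartbeats 400000 in
set_option maxHeartbeats 8000000 in
/-- **PKΠ — ENGINE LETTER (class U), the PER-PLACE CORE of PK**, verbatim from rung 3: ∃ `μ` (conjugate-symplectic, weight one) and `χ ∈ Chi` such that at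
EVERY finite place `v` SOME line class `ε_v ∈ (L⁺)ˣ` makes `σ ∘ inclPlace v` `X_v(μ, ε_v, χ) ∘ κ_v⁻¹`-isotypic. (print: Rogawski1990, Thm 13.3.6 (c), §13.1 p. 199)
(print: GelbartRogawski1991, Lem 5.1.2 p. 466) -/
def PKPiTarget : Prop :=
  ∀ (L : Type) [Field L] [NumberField L] [IsCMField L] (ι : L →+* ℂ) (H : Matrix (Fin 3) (Fin 3) L) (T : GL (Fin 3) ℂ)
    (hT : (T : Matrix (Fin 3) (Fin 3) ℂ)ᴴ * H.map ι * (T : Matrix (Fin 3) (Fin 3) ℂ) = Literature.Geometry.ComplexHyperbolic.BallModel.J),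
    (∀ τ' : L →+* ℂ, InfinitePlace.mk τ' ≠ InfinitePlace.mk ι → (H.map τ').PosDef) → 2 ≤ Module.finrank ℚ ↥(maximalRealSubfield L) →
    ∀ {n' : ℕ} (e₁ : Fin 3 × Fin 1 ≃ Fin n') (dV : Fin 3 → L) (hdV : ∀ i, IsCMField.complexConj L (dV i) = dV i)
      (hdV0 : ∀ i, dV i ≠ 0) (g : GL (Fin 3) L)
      (hg : ((g : Matrix (Fin 3) (Fin 3) L).map (cmConjRingHom L))ᵀ * H * (g : Matrix (Fin 3) (Fin 3) L) = Matrix.diagonal dV)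
      (ιV : finAdelic (↥(maximalRealSubfield L)) L (IsCMField.complexConj L) 3 H →*
          finAdelic (↥(maximalRealSubfield L)) L (IsCMField.complexConj L) 3 (Matrix.diagonal dV)),
        (∀ k, ((ιV k : finAdelic (↥(maximalRealSubfield L)) L (IsCMField.complexConj L) 3 (Matrix.diagonal dV)) :
            GL (Fin 3) (FiniteAdeleRing (𝓞 L) L)) =
          (toFinAdeleGL L 3 g)⁻¹ * (k : GL (Fin 3) (FiniteAdeleRing (𝓞 L) L)) * toFinAdeleGL L 3 g) →
        ∀ (μ : Measure (adelicGroupData (↥(maximalRealSubfield L)) L (IsCMField.complexConj L) 3 H).automorphicQuotient)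
          [(adelicGroupData (↥(maximalRealSubfield L)) L (IsCMField.complexConj L) 3 H).IsAutomorphicMeasure μ]
          (W : Type) [AddCommGroup W] [Module ℂ W]
          (σ : Representation ℂ (finAdelic (↥(maximalRealSubfield L)) L (IsCMField.complexConj L) 3 H) W),
          σ.IsIrreducible → σ.IsSmooth → σ.IsAdmissible →
          ∀ P : DiscreteAutomorphicRep (adelicGroupData (↥(maximalRealSubfield L)) L (IsCMField.complexConj L) 3 H) μ,
            (P.IsHolCotangentAt (cmArchSection L ι H T hT) (cmCompactFactor L ι H T hT) ∨
              P.IsAntiholCotangentAt (cmArchSection L ι H T hT) (cmCompactFactor L ι H T hT)) →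
            P.HasFinComponent σ →
            ∃ (μ : Literature.NumberTheory.Automorphic.IdeleClassGroup L →ₜ* Circle) (hμ : IsConjugateSymplectic L μ), HasWeight L μ 1 ∧
              ∃ (χ : Chi (↥(maximalRealSubfield L)) L (IsCMField.complexConj L)),
                ∀ (v : HeightOneSpectrum (𝓞 ↥(maximalRealSubfield L))), ∃ εv : (↥(maximalRealSubfield L))ˣ,
                    isotypicComponent (MonoidAlgebra ℂ (localPi L (IsCMField.complexConj L) 3 H v))
                      (Representation.asModule (σ.comp (inclPlace (↥(maximalRealSubfield L)) L (IsCMField.complexConj L) 3 H v)))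
                      (Representation.asModule
                        (((show Representation ℂ (localPi L (IsCMField.complexConj L) 3 (Matrix.diagonal dV) v) _ from
                          (TwistedCoinv.rep (localCharOfCenter (↥(maximalRealSubfield L)) L (IsCMField.complexConj L)
                              (JW (↥(maximalRealSubfield L)) L εv) (JW_apply_ne_zero (↥(maximalRealSubfield L)) L εv) χ.1 v)
                            ((OmegaChiSplitting.chiLocalSplittingsD ⟨L⟩ e₁ dV hdV hdV0 (toHeckeCharacter L μ)
                              ((isOscillatorChar_toHeckeCharacter_iff μ).mpr hμ) εv).omegaLoc v)
                            (commute_omegaLoc_localCenter (↥(maximalRealSubfield L)) L (IsCMField.complexConj L) 3 e₁ (Matrix.diagonal dV)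
                              (JW (↥(maximalRealSubfield L)) L εv) (complexConj_imagUnit L) (imagUnit_ne_zero L) (imagUnit_mul_self L)
                              (realDiagonal_isSymm L dV hdV) (isSymm_TW (↥(maximalRealSubfield L)) εv) (realDiagonal_map L dV hdV).symm
                              (JW_eq (↥(maximalRealSubfield L)) L εv) (JW_apply_ne_zero (↥(maximalRealSubfield L)) L εv)
                              (OmegaChiSplitting.chiLocalSplittingsD ⟨L⟩ e₁ dV hdV hdV0 (toHeckeCharacter L μ)
                                ((isOscillatorChar_toHeckeCharacter_iff μ).mpr hμ) εv) v)).comp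
                            (UnitaryGroup.localLineInl L (IsCMField.complexConj L) 3 e₁ (Matrix.diagonal dV) (JW (↥(maximalRealSubfield L)) L εv) v)) :
                            localPi L (IsCMField.complexConj L) 3 (Matrix.diagonal dV) v →* _).comp
                          (localCongr L (IsCMField.complexConj L) g one_ne_zero
                            (F0P2cOmegaLocalType.formCongr_frame L H dV g hg) v).symm.toMulEquiv.toMonoidHom)) = ⊤

/-! ## §1 Vocabulary of the cut: `IsoAt` (verbatim), `IsoAtXf` (plain `χf`), `ThetaTypeAt`, `GRDMatrix`; and the four statements -/

set_option synthInstance.maxHeartbeats 400000 in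
set_option maxHeartbeats 8000000 in
/-- **`IsoAt … σ μ hμ χ ε v`** (VERBATIM from rung 3) — «`σ ∘ inclPlace v` is `X_v(μ, ε, χ) ∘ κ_v⁻¹`-isotypic». (print: Liu2021, Def. 4.11 (l. 2090–2096), App. D Lem D.1)
(print: GelbartRogawski1991, Lem 5.1.2) -/
def IsoAt (L : Type) [Field L] [NumberField L] [IsCMField L] (H : Matrix (Fin 3) (Fin 3) L) {n' : ℕ} (e₁ : Fin 3 × Fin 1 ≃ Fin n') (dV : Fin 3 → L)
    (hdV : ∀ i, IsCMField.complexConj L (dV i) = dV i) (hdV0 : ∀ i, dV i ≠ 0) (g : GL (Fin 3) L)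
    (hg : ((g : Matrix (Fin 3) (Fin 3) L).map (cmConjRingHom L))ᵀ * H * (g : Matrix (Fin 3) (Fin 3) L) = Matrix.diagonal dV)
    {W : Type} [AddCommGroup W] [Module ℂ W] (σ : Representation ℂ (finAdelic (↥(maximalRealSubfield L)) L (IsCMField.complexConj L) 3 H) W)
    (μ : Literature.NumberTheory.Automorphic.IdeleClassGroup L →ₜ* Circle) (hμ : IsConjugateSymplectic L μ)
    (χ : Chi (↥(maximalRealSubfield L)) L (IsCMField.complexConj L)) (ε : (↥(maximalRealSubfield L))ˣ)
    (v : HeightOneSpectrum (𝓞 ↥(maximalRealSubfield L))) : Prop :=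
  isotypicComponent (MonoidAlgebra ℂ (localPi L (IsCMField.complexConj L) 3 H v))
    (Representation.asModule (σ.comp (inclPlace (↥(maximalRealSubfield L)) L (IsCMField.complexConj L) 3 H v)))
    (Representation.asModule
      (((show Representation ℂ (localPi L (IsCMField.complexConj L) 3 (Matrix.diagonal dV) v) _ from
        (TwistedCoinv.rep (localCharOfCenter (↥(maximalRealSubfield L)) L (IsCMField.complexConj L)
            (JW (↥(maximalRealSubfield L)) L ε) (JW_apply_ne_zero (↥(maximalRealSubfield L)) L ε) χ.1 v)
          ((OmegaChiSplitting.chiLocalSplittingsD ⟨L⟩ e₁ dV hdV hdV0 (toHeckeCharacter L μ)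
            ((isOscillatorChar_toHeckeCharacter_iff μ).mpr hμ) ε).omegaLoc v)
          (commute_omegaLoc_localCenter (↥(maximalRealSubfield L)) L (IsCMField.complexConj L) 3 e₁ (Matrix.diagonal dV)
            (JW (↥(maximalRealSubfield L)) L ε) (complexConj_imagUnit L) (imagUnit_ne_zero L) (imagUnit_mul_self L)
            (realDiagonal_isSymm L dV hdV) (isSymm_TW (↥(maximalRealSubfield L)) ε) (realDiagonal_map L dV hdV).symm
            (JW_eq (↥(maximalRealSubfield L)) L ε) (JW_apply_ne_zero (↥(maximalRealSubfield L)) L ε)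
            (OmegaChiSplitting.chiLocalSplittingsD ⟨L⟩ e₁ dV hdV hdV0 (toHeckeCharacter L μ)
              ((isOscillatorChar_toHeckeCharacter_iff μ).mpr hμ) ε) v)).comp
          (UnitaryGroup.localLineInl L (IsCMField.complexConj L) 3 e₁ (Matrix.diagonal dV) (JW (↥(maximalRealSubfield L)) L ε) v)) :
          localPi L (IsCMField.complexConj L) 3 (Matrix.diagonal dV) v →* _).comp
        (localCongr L (IsCMField.complexConj L) g one_ne_zero
          (F0P2cOmegaLocalType.formCongr_frame L H dV g hg) v).symm.toMulEquiv.toMonoidHom)) = ⊤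

set_option synthInstance.maxHeartbeats 400000 in
set_option maxHeartbeats 8000000 in
/-- **`IsoAtXf … σ μ hμ χf ε v`** — `IsoAt` with the automorphic `χ : Chi` replaced by a PLAIN character `χf : U(1)(𝔸_{L⁺,f}) →* ℂˣ` (the matrix reads `χ`
only through `χ.1`; automorphy of `χf` is RIG∞'s archimedean clause).  `IsoAt … ⟨χf, h⟩ … ↔ IsoAtXf … χf …` is `Iff.rfl` (§4 `isoAt_chi_mk`).
(print: Liu2021, Def. 4.11 (l. 2090–2096)) (print: GelbartRogawski1991, Lem 5.1.2) -/
def IsoAtXf (L : Type) [Field L] [NumberField L] [IsCMField L] (H : Matrix (Fin 3) (Fin 3) L) {n' : ℕ} (e₁ : Fin 3 × Fin 1 ≃ Fin n') (dV : Fin 3 → L)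
    (hdV : ∀ i, IsCMField.complexConj L (dV i) = dV i) (hdV0 : ∀ i, dV i ≠ 0) (g : GL (Fin 3) L)
    (hg : ((g : Matrix (Fin 3) (Fin 3) L).map (cmConjRingHom L))ᵀ * H * (g : Matrix (Fin 3) (Fin 3) L) = Matrix.diagonal dV)
    {W : Type} [AddCommGroup W] [Module ℂ W] (σ : Representation ℂ (finAdelic (↥(maximalRealSubfield L)) L (IsCMField.complexConj L) 3 H) W)
    (μ : Literature.NumberTheory.Automorphic.IdeleClassGroup L →ₜ* Circle) (hμ : IsConjugateSymplectic L μ)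
    (χf : UnitaryGroup.finAdelicOne (↥(maximalRealSubfield L)) L (IsCMField.complexConj L) →* ℂˣ) (ε : (↥(maximalRealSubfield L))ˣ)
    (v : HeightOneSpectrum (𝓞 ↥(maximalRealSubfield L))) : Prop :=
  isotypicComponent (MonoidAlgebra ℂ (localPi L (IsCMField.complexConj L) 3 H v))
    (Representation.asModule (σ.comp (inclPlace (↥(maximalRealSubfield L)) L (IsCMField.complexConj L) 3 H v)))
    (Representation.asModule
      (((show Representation ℂ (localPi L (IsCMField.complexConj L) 3 (Matrix.diagonal dV) v) _ from
        (TwistedCoinv.rep (localCharOfCenter (↥(maximalRealSubfield L)) L (IsCMField.complexConj L)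
            (JW (↥(maximalRealSubfield L)) L ε) (JW_apply_ne_zero (↥(maximalRealSubfield L)) L ε) χf v)
          ((OmegaChiSplitting.chiLocalSplittingsD ⟨L⟩ e₁ dV hdV hdV0 (toHeckeCharacter L μ)
            ((isOscillatorChar_toHeckeCharacter_iff μ).mpr hμ) ε).omegaLoc v)
          (commute_omegaLoc_localCenter (↥(maximalRealSubfield L)) L (IsCMField.complexConj L) 3 e₁ (Matrix.diagonal dV)
            (JW (↥(maximalRealSubfield L)) L ε) (complexConj_imagUnit L) (imagUnit_ne_zero L) (imagUnit_mul_self L)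
            (realDiagonal_isSymm L dV hdV) (isSymm_TW (↥(maximalRealSubfield L)) ε) (realDiagonal_map L dV hdV).symm
            (JW_eq (↥(maximalRealSubfield L)) L ε) (JW_apply_ne_zero (↥(maximalRealSubfield L)) L ε)
            (OmegaChiSplitting.chiLocalSplittingsD ⟨L⟩ e₁ dV hdV hdV0 (toHeckeCharacter L μ)
              ((isOscillatorChar_toHeckeCharacter_iff μ).mpr hμ) ε) v)).comp
          (UnitaryGroup.localLineInl L (IsCMField.complexConj L) 3 e₁ (Matrix.diagonal dV) (JW (↥(maximalRealSubfield L)) L ε) v)) :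
          localPi L (IsCMField.complexConj L) 3 (Matrix.diagonal dV) v →* _).comp
        (localCongr L (IsCMField.complexConj L) g one_ne_zero
          (F0P2cOmegaLocalType.formCongr_frame L H dV g hg) v).symm.toMulEquiv.toMonoidHom)) = ⊤

set_option synthInstance.maxHeartbeats 400000 in
set_option maxHeartbeats 8000000 in
/-- **`ThetaTypeAt … μ hμ χf ε v c`** — «the class `c ∈ Irr(U(H)(L⁺_v))` (D6 carrier `(cmDatum L 3 H).Local v`, read on `localPi v` through ★ `localPiEquiv v`)
IS the theta type `X_v(μ, ε, χf) ∘ κ_v⁻¹`», in LOCAL-TYPE currency (the shape ★ LTY-c p816375 delivers): for every irreducible `τ` on `T : Type` of which the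
pulled-back class is a constituent (so `τ` represents `c`), every `τ`-isotypic smooth representation `ρ′` of `U(H)(L⁺_v)` is `X_v(μ,ε,χf) ∘ κ_v⁻¹`-isotypic (the
head never transports `isotypicComponent` along an equivalence — that bookkeeping is inside the predicate, an S prover row «theta-type criterion»).
«the members of `Π(ξ_v)` occur in the Weil representation». (print: GelbartRogawski1991, §5.1 (5.1.1), Lem 5.1.2 p. 466) (print: BourbakiAlgebreVIII2012, VIII §4 n°2) -/
def ThetaTypeAt (L : Type) [Field L] [NumberField L] [IsCMField L] (H : Matrix (Fin 3) (Fin 3) L) {n' : ℕ} (e₁ : Fin 3 × Fin 1 ≃ Fin n') (dV : Fin 3 → L)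
    (hdV : ∀ i, IsCMField.complexConj L (dV i) = dV i) (hdV0 : ∀ i, dV i ≠ 0) (g : GL (Fin 3) L)
    (hg : ((g : Matrix (Fin 3) (Fin 3) L).map (cmConjRingHom L))ᵀ * H * (g : Matrix (Fin 3) (Fin 3) L) = Matrix.diagonal dV)
    (μ : Literature.NumberTheory.Automorphic.IdeleClassGroup L →ₜ* Circle) (hμ : IsConjugateSymplectic L μ)
    (χf : UnitaryGroup.finAdelicOne (↥(maximalRealSubfield L)) L (IsCMField.complexConj L) →* ℂˣ) (ε : (↥(maximalRealSubfield L))ˣ)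
    (v : HeightOneSpectrum (𝓞 ↥(maximalRealSubfield L))) (c : IrrClass ((cmDatum L 3 H).Local v)) : Prop :=
  ∀ (T : Type) [AddCommGroup T] [Module ℂ T] (τ : Representation ℂ ↥(localPi L (IsCMField.complexConj L) 3 H v) T), τ.IsIrreducible →
    (IrrClass.comap (localPiEquiv L (IsCMField.complexConj L) 3 H v) c).IsConstituentOf τ →
    ∀ (W' : Type) [AddCommGroup W'] [Module ℂ W'] (ρ' : Representation ℂ ↥(localPi L (IsCMField.complexConj L) 3 H v) W'),
      isotypicComponent (MonoidAlgebra ℂ (localPi L (IsCMField.complexConj L) 3 H v)) (Representation.asModule ρ')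
          (Representation.asModule τ) = ⊤ →
      isotypicComponent (MonoidAlgebra ℂ (localPi L (IsCMField.complexConj L) 3 H v)) (Representation.asModule ρ')
        (Representation.asModule
          (((show Representation ℂ (localPi L (IsCMField.complexConj L) 3 (Matrix.diagonal dV) v) _ from
            (TwistedCoinv.rep (localCharOfCenter (↥(maximalRealSubfield L)) L (IsCMField.complexConj L)
                (JW (↥(maximalRealSubfield L)) L ε) (JW_apply_ne_zero (↥(maximalRealSubfield L)) L ε) χf v)
              ((OmegaChiSplitting.chiLocalSplittingsD ⟨L⟩ e₁ dV hdV hdV0 (toHeckeCharacter L μ)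
                ((isOscillatorChar_toHeckeCharacter_iff μ).mpr hμ) ε).omegaLoc v)
              (commute_omegaLoc_localCenter (↥(maximalRealSubfield L)) L (IsCMField.complexConj L) 3 e₁ (Matrix.diagonal dV)
                (JW (↥(maximalRealSubfield L)) L ε) (complexConj_imagUnit L) (imagUnit_ne_zero L) (imagUnit_mul_self L)
                (realDiagonal_isSymm L dV hdV) (isSymm_TW (↥(maximalRealSubfield L)) ε) (realDiagonal_map L dV hdV).symm
                (JW_eq (↥(maximalRealSubfield L)) L ε) (JW_apply_ne_zero (↥(maximalRealSubfield L)) L ε)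
                (OmegaChiSplitting.chiLocalSplittingsD ⟨L⟩ e₁ dV hdV hdV0 (toHeckeCharacter L μ)
                  ((isOscillatorChar_toHeckeCharacter_iff μ).mpr hμ) ε) v)).comp
              (UnitaryGroup.localLineInl L (IsCMField.complexConj L) 3 e₁ (Matrix.diagonal dV) (JW (↥(maximalRealSubfield L)) L ε) v)) :
              localPi L (IsCMField.complexConj L) 3 (Matrix.diagonal dV) v →* _).comp
            (localCongr L (IsCMField.complexConj L) g one_ne_zero
              (F0P2cOmegaLocalType.formCongr_frame L H dV g hg) v).symm.toMulEquiv.toMonoidHom)) = ⊤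

set_option synthInstance.maxHeartbeats 400000 in
set_option maxHeartbeats 8000000 in
/-- **`GRDMatrix … ξ μω hμu μ hμ χf` — THE FINITE GELBART–ROGAWSKI DICTIONARY as a predicate on the pair `(μ, χf)`** relative to `ξ = (η, ψ)` (★ D5
`OneDimAutRepH`) and Rogawski's auxiliary `μω`: (S) at a place `v` SPLIT in `L`, every member of every ξ-local family `Pv` (★ D6 `IsXiLocalFamily`; there
`Pv v` is the singleton ★ `cmSplitPacket` `{i_G(ξ_w ⊗ μ_w∘det₀)}`) is a `(μ,χf)`-theta type of some line class [Rogawski1990 Lemma 4.13.1 (b); Minguez2008 Thm. 1];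
(N) at a NON-SPLIT `v`, for every form congruence `ᵗT̄·H_v·T = a·Φ₃` (the D6 binders verbatim), SOME constituent `x₀ ∈ JH(i_G(χ_ξ))` transported along ★
`cmDatumLocalCongr` is a `(μ,χf)`-theta type of some line class — in print `x₀ = πⁿ(ξ_v)`, the Weil-representation lift [GelbartRogawski1991 (5.1.1), Lem 5.1.2;
Haan2015 Thm. 3.4 (ii): the class depends on a local root number, hence `∃ ε`].  No Haar measure, no `π²`∕`πˢ` label.
(print: GelbartRogawski1991, §5.1 (5.1.1), Lem 5.1.2 p. 466) (print: Rogawski1990, Lemma 4.13.1 (b) p. 62; §12.2 (2) p. 174; §13.1 p. 199) -/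
def GRDMatrix (L : Type) [Field L] [NumberField L] [IsCMField L] (H : Matrix (Fin 3) (Fin 3) L) (hH : (H.map (cmConjRingHom L))ᵀ = H) (hHd : IsUnit H.det)
    {n' : ℕ} (e₁ : Fin 3 × Fin 1 ≃ Fin n') (dV : Fin 3 → L) (hdV : ∀ i, IsCMField.complexConj L (dV i) = dV i) (hdV0 : ∀ i, dV i ≠ 0) (g : GL (Fin 3) L)
    (hg : ((g : Matrix (Fin 3) (Fin 3) L).map (cmConjRingHom L))ᵀ * H * (g : Matrix (Fin 3) (Fin 3) L) = Matrix.diagonal dV)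
    (ξ : OneDimAutRepH L) (μω : HeckeCharacter L) (hμu : μω.IsUnitary)
    (μ : Literature.NumberTheory.Automorphic.IdeleClassGroup L →ₜ* Circle) (hμ : IsConjugateSymplectic L μ)
    (χf : UnitaryGroup.finAdelicOne (↥(maximalRealSubfield L)) L (IsCMField.complexConj L) →* ℂˣ) : Prop :=
  (∀ Pv : ∀ v : HeightOneSpectrum (𝓞 ↥(maximalRealSubfield L)), CMLocalAPacket L H v,
      ξ.IsXiLocalFamily hH hHd μω hμu Pv →
      ∀ (v : HeightOneSpectrum (𝓞 ↥(maximalRealSubfield L))),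
        (∃ w : PlacesOver L v, IsCMField.complexConj L • w.1 ≠ w.1) →
        ∀ c : IrrClass ((cmDatum L 3 H).Local v), c ∈ (Pv v).members →
          ∃ ε : (↥(maximalRealSubfield L))ˣ, ThetaTypeAt L H e₁ dV hdV hdV0 g hg μ hμ χf ε v c) ∧
  (∀ (v : HeightOneSpectrum (𝓞 ↥(maximalRealSubfield L))),
      (∀ w : PlacesOver L v, IsCMField.complexConj L • w.1 = w.1) →
      ∀ (T : GL (Fin 3) (UnitaryGroup.LocalRing L v)) (a : UnitaryGroup.LocalRing L v) (ha : IsUnit a)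
        (h : formCongr (conjLocal L (IsCMField.complexConj L) v) T (H.map (algebraMap L (UnitaryGroup.LocalRing L v))) =
          a • (Matrix.of fun i j : Fin 3 => if i.val + j.val + 1 = 3 then (1 : L) else 0).map (algebraMap L (UnitaryGroup.LocalRing L v))),
        ∃ x₀ : IrrClass (Gqs L v),
          x₀.IsConstituentOf (cmPrincipalSeries L 3 v (cmXiTorusChar L v (μω.semilocalComponent L v)
            (torusLocalComponent L (IsCMField.complexConj L) v ξ.η) (torusLocalComponent L (IsCMField.complexConj L) v ξ.ψ))) ∧
          ∃ ε : (↥(maximalRealSubfield L))ˣ,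
            ThetaTypeAt L H e₁ dV hdV hdV0 g hg μ hμ χf ε v (IrrClass.comap (cmDatumLocalCongr L v T ha h).symm x₀))

set_option synthInstance.maxHeartbeats 400000 in
set_option maxHeartbeats 8000000 in
/-- **GRD — THE GELBART–ROGAWSKI DICTIONARY EXISTS (LOCAL ∃, class U′ print ∕ in-house L)**: for every one-dimensional automorphic `ξ = (η,ψ)` of `H` and
Rogawski's `μω` (unitary, `μω|_{𝕀_{L⁺}} = ω_{L/L⁺}`), and every theta frame of `U(H)`, there is a pair `(μ₀, χf)` — `μ₀` conjugate-symplectic, `χf` a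
CONTINUOUS character of `U(1)(𝔸_{L⁺,f})` — such that EVERY conjugate-symplectic `μ` with the same semi-local components as `μ₀` at all finite places of `L⁺`
satisfies the finite dictionary `GRDMatrix`.  In print `μ₀ = μ_ξ` («`φ = μ η̃`, `η̃(a) = η(a/ā)`», [Rogawski1990 §13.3 p. 195]; [GelbartRogawski1991 (5.1.1)]) and
`χf` = the central character of `Π(ξ)_f`; the formula and its sign conventions are the PROVER's, deliberately not typed (dead line «μOf by formula»); the
`∀ μ` clause is the locality of `X_v` in `μ_v`.  Why it might fail as typed: the split identification `i_G(ξ_w ⊗ μ_w∘det₀) = Θ(χ)` (type II, [Minguez2008 Thm. 1]) and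
the `‖·‖^{1/2}` of `χ_ξ` at the tree's normalisations (`splitν₀`, `locψ`, `JW`, `chiLocalSplittingsD`).
(print: GelbartRogawski1991, §5.1 (5.1.1), Lem 5.1.2 p. 466) (print: Rogawski1990, §13.3 p. 195; Lemma 4.13.1 (b) p. 62; §12.2 (2) p. 174) (print: Minguez2008, Thm. 1) -/
def StubGRD : Prop :=
  ∀ (L : Type) [Field L] [NumberField L] [IsCMField L] (H : Matrix (Fin 3) (Fin 3) L) (hH : (H.map (cmConjRingHom L))ᵀ = H) (hHd : IsUnit H.det)
    {n' : ℕ} (e₁ : Fin 3 × Fin 1 ≃ Fin n') (dV : Fin 3 → L) (hdV : ∀ i, IsCMField.complexConj L (dV i) = dV i) (hdV0 : ∀ i, dV i ≠ 0) (g : GL (Fin 3) L)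
    (hg : ((g : Matrix (Fin 3) (Fin 3) L).map (cmConjRingHom L))ᵀ * H * (g : Matrix (Fin 3) (Fin 3) L) = Matrix.diagonal dV)
    (ξ : OneDimAutRepH L) (μω : HeckeCharacter L) (hμu : μω.IsUnitary),
    (∀ x : Literature.NumberTheory.GaloisRepresentations.ideleGroup ↥(maximalRealSubfield L), μω (AdeleRing.ideleBaseChange (↥(maximalRealSubfield L)) L x) = quadraticHeckeCharCM L x) →
    ∃ (μ₀ : Literature.NumberTheory.Automorphic.IdeleClassGroup L →ₜ* Circle) (_hμ₀ : IsConjugateSymplectic L μ₀)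
      (χf : UnitaryGroup.finAdelicOne (↥(maximalRealSubfield L)) L (IsCMField.complexConj L) →* ℂˣ),
      Continuous χf ∧ (∀ z, ‖((χf z : ℂˣ) : ℂ)‖ = 1) ∧
      ∀ (μ : Literature.NumberTheory.Automorphic.IdeleClassGroup L →ₜ* Circle) (hμ : IsConjugateSymplectic L μ),
        (∀ v : HeightOneSpectrum (𝓞 ↥(maximalRealSubfield L)),
          (toHeckeCharacter L μ).semilocalComponent L v = (toHeckeCharacter L μ₀).semilocalComponent L v) →
        GRDMatrix L H hH hHd e₁ dV hdV hdV0 g hg ξ μω hμu μ hμ χf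

set_option synthInstance.maxHeartbeats 400000 in
set_option maxHeartbeats 8000000 in
/-- **RIG∞ — ARCHIMEDEAN RIGIDITY (ENGINE, class U)**: for a COTANGENT (hol ∨ antihol at `ι`, trivial on the compact factor) discrete `P` of `U(H)` in the
ξ-envelope (★ `MemXiFamily`, finite places only — ruling Q1) and any pair `(μ₀, χf)`, `χf` continuous, satisfying the finite dictionary: there is `μ1`
conjugate-symplectic of WEIGHT ONE with the same finite semi-local components as `μ₀`, and `χf` is automorphic (`∈ Chi`).  In print: `P ∈ Π(ξ)` genuinely
[Rogawski1990 Thm. 13.3.6 (c), 14.6.4], `P_ι = πⁿ(ξ_ι) ∈ {J⁺, J⁻}` and `P_{ι′} = 𝟙` pin `ξ_∞` of cohomological type [Prop. 12.3.3, 15.2.1 (b)], whence `μ_ξ` has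
weight one [Liu2021 Lem. (le:weil_arch), Prop. 4.13 Case 1: «`χ_∞ = 1` … `π^∞ ≅ ω(μ, ε, χ)`»] and `χf = ω_{P,f}` (the centre `Z(L⊗ℝ) ⊂ K_∞` acts trivially on
the cotangent `K`-type) is trivial on `L¹`; the finite matrix pins `(μ_f, χf)` (continuity, density of `⊕_v U(H)(L⁺_v)`), so the `∀ (μ₀, χf)` form holds.  Why it
might fail as typed: a bare «finite matrix ⇒ weight one of `μ₀`» is FALSE (twists `μ₀ ν̃`, `ν_f = 1`) — hence `∃ μ1`; nothing else known.
(print: Rogawski1990, Prop. 12.3.3 p. 178; Prop. 15.2.1 (b); Thm. 13.3.6 (c); Thm. 14.6.4) (print: Liu2021, Prop. 4.13 (Case 1), Lem. (le:weil_arch)) -/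
def StubRIGinf : Prop :=
  ∀ (L : Type) [Field L] [NumberField L] [IsCMField L] (ι : L →+* ℂ) (H : Matrix (Fin 3) (Fin 3) L) (T : GL (Fin 3) ℂ)
    (hT : (T : Matrix (Fin 3) (Fin 3) ℂ)ᴴ * H.map ι * (T : Matrix (Fin 3) (Fin 3) ℂ) = Literature.Geometry.ComplexHyperbolic.BallModel.J),
    (∀ τ' : L →+* ℂ, InfinitePlace.mk τ' ≠ InfinitePlace.mk ι → (H.map τ').PosDef) → 2 ≤ Module.finrank ℚ ↥(maximalRealSubfield L) →
    ∀ {n' : ℕ} (e₁ : Fin 3 × Fin 1 ≃ Fin n') (dV : Fin 3 → L) (hdV : ∀ i, IsCMField.complexConj L (dV i) = dV i)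
      (hdV0 : ∀ i, dV i ≠ 0) (g : GL (Fin 3) L)
      (hg : ((g : Matrix (Fin 3) (Fin 3) L).map (cmConjRingHom L))ᵀ * H * (g : Matrix (Fin 3) (Fin 3) L) = Matrix.diagonal dV)
      (μ : Measure (adelicGroupData (↥(maximalRealSubfield L)) L (IsCMField.complexConj L) 3 H).automorphicQuotient)
      [(adelicGroupData (↥(maximalRealSubfield L)) L (IsCMField.complexConj L) 3 H).IsAutomorphicMeasure μ]
      (μω : HeckeCharacter L) (hμu : μω.IsUnitary),
      (∀ x : Literature.NumberTheory.GaloisRepresentations.ideleGroup ↥(maximalRealSubfield L), μω (AdeleRing.ideleBaseChange (↥(maximalRealSubfield L)) L x) = quadraticHeckeCharCM L x) →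
    ∀ (P : DiscreteAutomorphicRep (adelicGroupData (↥(maximalRealSubfield L)) L (IsCMField.complexConj L) 3 H) μ),
      (P.IsHolCotangentAt (cmArchSection L ι H T hT) (cmCompactFactor L ι H T hT) ∨
        P.IsAntiholCotangentAt (cmArchSection L ι H T hT) (cmCompactFactor L ι H T hT)) →
    ∀ (ξ : OneDimAutRepH L),
      MemXiFamily P (transpose_map_cmConjRingHom_eq_of_frame L ι H T hT) (isUnit_det_of_frame L ι H T hT) μω hμu ξ →
    ∀ (μ₀ : Literature.NumberTheory.Automorphic.IdeleClassGroup L →ₜ* Circle) (hμ₀ : IsConjugateSymplectic L μ₀)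
      (χf : UnitaryGroup.finAdelicOne (↥(maximalRealSubfield L)) L (IsCMField.complexConj L) →* ℂˣ),
      Continuous χf → (∀ z, ‖((χf z : ℂˣ) : ℂ)‖ = 1) →
      GRDMatrix L H (transpose_map_cmConjRingHom_eq_of_frame L ι H T hT) (isUnit_det_of_frame L ι H T hT) e₁ dV hdV hdV0 g hg ξ μω hμu μ₀ hμ₀ χf →
      ∃ (μ1 : Literature.NumberTheory.Automorphic.IdeleClassGroup L →ₜ* Circle) (_hμ1 : IsConjugateSymplectic L μ1),
        HasWeight L μ1 1 ∧
        (∀ v : HeightOneSpectrum (𝓞 ↥(maximalRealSubfield L)),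
          (toHeckeCharacter L μ1).semilocalComponent L v = (toHeckeCharacter L μ₀).semilocalComponent L v) ∧
        IsAutomorphicOneChar (↥(maximalRealSubfield L)) L (IsCMField.complexConj L) χf

set_option synthInstance.maxHeartbeats 400000 in
set_option maxHeartbeats 8000000 in
/-- **RIGf — NON-SPLIT RIGIDITY (ENGINE, class U)**: for a COTANGENT discrete `P` of `U(H)` in the ξ-envelope with finite component `σ` (irreducible,
admissible), and any pair `(μ, χf)` satisfying the finite dictionary, at every place `v` of `L⁺` that does NOT split in `L` some line class `ε` makes
`σ ∘ inclPlace v` `X_v(μ, ε, χf) ∘ κ_v⁻¹`-isotypic.  In print: the local type of `σ` at `v` lies in Rogawski's A-packet `Π(ξ_v) = {πⁿ(ξ_v), πˢ(ξ_v)}` [Thm.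
13.3.6 (c), 13.3.7; Prop. 13.1.3 (d), 13.1.4 — not the square-integrable `π²(ξ_v)`, and the supercuspidal member is the one pinned by the character identities],
`πⁿ(ξ_v)` is the (N)-slot of the dictionary and `πˢ(ξ_v) = Θ_{V⁻}(χ)` is the theta type of the other line class [GelbartRogawski1991 Prop. 5.2.2;
GelbartRogawskiSoudry1997 Prop. 2.5.1 (b); Haan2015 Thm. 3.4 (ii)] — P3's rigidity rows Z4∕Z5∕Z7 and the parked D7′ (s496 D-b), in theta currency.  Strictly
weaker than PKΠ (non-split places only; `ξ`, `(μ,χf)` and envelope membership GIVEN; no weight, no `Chi`).  Why it might fail as typed: only with D7′ at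
ramified non-split `v` (covered by GRS97). (print: Rogawski1990, Thm. 13.3.6 (c); Thm. 13.3.7; Prop. 13.1.3 (d); §13.1 p. 199) (print: GelbartRogawski1991, Prop. 5.2.2 p. 467)
(print: GelbartRogawskiSoudry1997, Prop. 2.5.1 (b)) -/
def StubRIGf : Prop :=
  ∀ (L : Type) [Field L] [NumberField L] [IsCMField L] (ι : L →+* ℂ) (H : Matrix (Fin 3) (Fin 3) L) (T : GL (Fin 3) ℂ)
    (hT : (T : Matrix (Fin 3) (Fin 3) ℂ)ᴴ * H.map ι * (T : Matrix (Fin 3) (Fin 3) ℂ) = Literature.Geometry.ComplexHyperbolic.BallModel.J),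
    (∀ τ' : L →+* ℂ, InfinitePlace.mk τ' ≠ InfinitePlace.mk ι → (H.map τ').PosDef) → 2 ≤ Module.finrank ℚ ↥(maximalRealSubfield L) →
    ∀ {n' : ℕ} (e₁ : Fin 3 × Fin 1 ≃ Fin n') (dV : Fin 3 → L) (hdV : ∀ i, IsCMField.complexConj L (dV i) = dV i)
      (hdV0 : ∀ i, dV i ≠ 0) (g : GL (Fin 3) L)
      (hg : ((g : Matrix (Fin 3) (Fin 3) L).map (cmConjRingHom L))ᵀ * H * (g : Matrix (Fin 3) (Fin 3) L) = Matrix.diagonal dV)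
      (μ : Measure (adelicGroupData (↥(maximalRealSubfield L)) L (IsCMField.complexConj L) 3 H).automorphicQuotient)
      [(adelicGroupData (↥(maximalRealSubfield L)) L (IsCMField.complexConj L) 3 H).IsAutomorphicMeasure μ]
      (μω : HeckeCharacter L) (hμu : μω.IsUnitary),
      (∀ x : Literature.NumberTheory.GaloisRepresentations.ideleGroup ↥(maximalRealSubfield L), μω (AdeleRing.ideleBaseChange (↥(maximalRealSubfield L)) L x) = quadraticHeckeCharCM L x) →
    ∀ (W : Type) [AddCommGroup W] [Module ℂ W]
      (σ : Representation ℂ (finAdelic (↥(maximalRealSubfield L)) L (IsCMField.complexConj L) 3 H) W),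
      σ.IsIrreducible → σ.IsSmooth → σ.IsAdmissible →
    ∀ (P : DiscreteAutomorphicRep (adelicGroupData (↥(maximalRealSubfield L)) L (IsCMField.complexConj L) 3 H) μ),
      (P.IsHolCotangentAt (cmArchSection L ι H T hT) (cmCompactFactor L ι H T hT) ∨
        P.IsAntiholCotangentAt (cmArchSection L ι H T hT) (cmCompactFactor L ι H T hT)) →
      P.HasFinComponent σ →
    ∀ (ξ : OneDimAutRepH L),
      MemXiFamily P (transpose_map_cmConjRingHom_eq_of_frame L ι H T hT) (isUnit_det_of_frame L ι H T hT) μω hμu ξ →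
    ∀ (μ1 : Literature.NumberTheory.Automorphic.IdeleClassGroup L →ₜ* Circle) (hμ1 : IsConjugateSymplectic L μ1)
      (χf : UnitaryGroup.finAdelicOne (↥(maximalRealSubfield L)) L (IsCMField.complexConj L) →* ℂˣ),
      Continuous χf → (∀ z, ‖((χf z : ℂˣ) : ℂ)‖ = 1) →
      GRDMatrix L H (transpose_map_cmConjRingHom_eq_of_frame L ι H T hT) (isUnit_det_of_frame L ι H T hT) e₁ dV hdV hdV0 g hg ξ μω hμu μ1 hμ1 χf →
      ∀ (v : HeightOneSpectrum (𝓞 ↥(maximalRealSubfield L))),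
        (∀ w : PlacesOver L v, IsCMField.complexConj L • w.1 = w.1) →
        ∃ ε : (↥(maximalRealSubfield L))ˣ, IsoAtXf L H e₁ dV hdV hdV0 g hg σ μ1 hμ1 χf ε v

set_option synthInstance.maxHeartbeats 400000 in
set_option maxHeartbeats 8000000 in
/-- **RIGf ON THE DICTIONARY PAIR (v1.7 «D7α SPLIT» re-cut)**: `StubRIGf` with `GRDMatrix … →` replaced by the two DICTIONARY equations of letter #76 (the
head only ever applies RIGf at the GRD witness `(grdMu, grdChi)`, where they hold by ★ `F0P2iGRDWitness.semilocalComponent_toHeckeCharacter_grdMu` ∕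
`grdChi_finAdelicCheck`) — the currency of #75-loc and of the docking clause. (print: Rogawski1990, Thm. 13.3.6 (c); Prop. 13.1.3 (d)) (print: GelbartRogawski1991, Lem. 5.1.2) -/
def StubRIGfDict : Prop :=
  ∀ (L : Type) [Field L] [NumberField L] [IsCMField L] (ι : L →+* ℂ) (H : Matrix (Fin 3) (Fin 3) L) (T : GL (Fin 3) ℂ)
    (hT : (T : Matrix (Fin 3) (Fin 3) ℂ)ᴴ * H.map ι * (T : Matrix (Fin 3) (Fin 3) ℂ) = Literature.Geometry.ComplexHyperbolic.BallModel.J),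
    (∀ τ' : L →+* ℂ, InfinitePlace.mk τ' ≠ InfinitePlace.mk ι → (H.map τ').PosDef) → 2 ≤ Module.finrank ℚ ↥(maximalRealSubfield L) →
    ∀ {n' : ℕ} (e₁ : Fin 3 × Fin 1 ≃ Fin n') (dV : Fin 3 → L) (hdV : ∀ i, IsCMField.complexConj L (dV i) = dV i)
      (hdV0 : ∀ i, dV i ≠ 0) (g : GL (Fin 3) L)
      (hg : ((g : Matrix (Fin 3) (Fin 3) L).map (cmConjRingHom L))ᵀ * H * (g : Matrix (Fin 3) (Fin 3) L) = Matrix.diagonal dV)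
      (μ : Measure (adelicGroupData (↥(maximalRealSubfield L)) L (IsCMField.complexConj L) 3 H).automorphicQuotient)
      [(adelicGroupData (↥(maximalRealSubfield L)) L (IsCMField.complexConj L) 3 H).IsAutomorphicMeasure μ]
      (μω : HeckeCharacter L) (hμu : μω.IsUnitary),
      (∀ x : Literature.NumberTheory.GaloisRepresentations.ideleGroup ↥(maximalRealSubfield L), μω (AdeleRing.ideleBaseChange (↥(maximalRealSubfield L)) L x) = quadraticHeckeCharCM L x) →
    ∀ (W : Type) [AddCommGroup W] [Module ℂ W]
      (σ : Representation ℂ (finAdelic (↥(maximalRealSubfield L)) L (IsCMField.complexConj L) 3 H) W),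
      σ.IsIrreducible → σ.IsSmooth → σ.IsAdmissible →
    ∀ (P : DiscreteAutomorphicRep (adelicGroupData (↥(maximalRealSubfield L)) L (IsCMField.complexConj L) 3 H) μ),
      (P.IsHolCotangentAt (cmArchSection L ι H T hT) (cmCompactFactor L ι H T hT) ∨
        P.IsAntiholCotangentAt (cmArchSection L ι H T hT) (cmCompactFactor L ι H T hT)) →
      P.HasFinComponent σ →
    ∀ (ξ : OneDimAutRepH L),
      MemXiFamily P (transpose_map_cmConjRingHom_eq_of_frame L ι H T hT) (isUnit_det_of_frame L ι H T hT) μω hμu ξ →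
    ∀ (μ1 : Literature.NumberTheory.Automorphic.IdeleClassGroup L →ₜ* Circle) (hμ1 : IsConjugateSymplectic L μ1)
      (χf : UnitaryGroup.finAdelicOne (↥(maximalRealSubfield L)) L (IsCMField.complexConj L) →* ℂˣ),
      Continuous χf → (∀ z, ‖((χf z : ℂˣ) : ℂ)‖ = 1) →
      -- WEIGHT-ONE AUTOMORPHIC LOCUS (v1.16 «W1»): the head applies RIGf only at the GRD witness, where `hw`∕`haut` hold by ★ `rigInf_node_of_xiArchPinned`
      HasWeight L μ1 1 → IsAutomorphicOneChar (↥(maximalRealSubfield L)) L (IsCMField.complexConj L) χf →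
      -- DICTIONARY (μ): `μ̃ = η̃⁻¹ · ψ̃⁻¹ · μω`, semi-locally at every finite place of `L⁺` (verbatim from #76)
      (∀ v : HeightOneSpectrum (𝓞 ↥(maximalRealSubfield L)),
      (toHeckeCharacter L μ1).semilocalComponent L v = (ξ.bcη⁻¹ * ξ.bcψ⁻¹ * μω).semilocalComponent L v) →
      -- DICTIONARY (χ_f): `χ_f (z / z̄) = (ψ̃⁻¹ · (η̃⁻¹ ψ̃⁻¹ μω)²) ((1_∞, z))` for every finite idèle `z` of `L` (verbatim from #76)
      (∀ z : (FiniteAdeleRing (𝓞 L) L)ˣ,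
      χf (finAdelicCheck (↥(maximalRealSubfield L)) L (IsCMField.complexConj L)
      (AlgEquiv.ext fun x => by rw [AlgEquiv.mul_apply, IsCMField.complexConj_apply_apply, AlgEquiv.one_apply]) z) =
      (ξ.bcψ⁻¹ * (ξ.bcη⁻¹ * ξ.bcψ⁻¹ * μω) ^ 2)
      (Units.map (N := AdeleRing (𝓞 L) L) (MonoidHom.inr (InfiniteAdeleRing L) (FiniteAdeleRing (𝓞 L) L)) z)) →
      ∀ (v : HeightOneSpectrum (𝓞 ↥(maximalRealSubfield L))),
        (∀ w : PlacesOver L v, IsCMField.complexConj L • w.1 = w.1) →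
        ∃ ε : (↥(maximalRealSubfield L))ˣ, IsoAtXf L H e₁ dV hdV hdV0 g hg σ μ1 hμ1 χf ε v

set_option synthInstance.maxHeartbeats 400000 in
set_option maxHeartbeats 8000000 in
/-- **MEM + DOCK (v1.7, ONE joint ∃-stub on SHARED record data; borel σ-algebras as at 𝔠₀)**: for every frame, record data `(Δ, mH, mG, νG, νH, ξloc, μZ, keys, hCM)`
exist such that (DOCK) the theta-docking clause [Rogawski1990 Prop. 13.1.3 (d), 13.1.4; GelbartRogawski1991 Lem. 5.1.2] holds for every theta frame and every `ξ`, and (MEM)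
every local constituent class of a cotangent `P`'s finite component at a non-split place lies in the packet OF RECORD of its `ξ` (★ `xiPacketFamilyOfRecord`)
[Rogawski1990 Thm. 13.3.7, §14.6]. (print: Rogawski1990, §13.1 Prop. 13.1.3 (d), Prop. 13.1.4 p. 199; Thm. 13.3.7; §14.6 p. 246) (print: GelbartRogawski1991, Lem. 5.1.2 p. 466) -/
def StubD7αMemDock : Prop :=
  ∀ (L : Type) [Field L] [NumberField L] [IsCMField L] (ι : L →+* ℂ) (H : Matrix (Fin 3) (Fin 3) L) (T : GL (Fin 3) ℂ)
    (hT : (T : Matrix (Fin 3) (Fin 3) ℂ)ᴴ * H.map ι * (T : Matrix (Fin 3) (Fin 3) ℂ) = Literature.Geometry.ComplexHyperbolic.BallModel.J),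
    (∀ τ' : L →+* ℂ, InfinitePlace.mk τ' ≠ InfinitePlace.mk ι → (H.map τ').PosDef) → 2 ≤ Module.finrank ℚ ↥(maximalRealSubfield L) →
    ∀ (μω : HeckeCharacter L) (hμu : μω.IsUnitary),
      (∀ x : Literature.NumberTheory.GaloisRepresentations.ideleGroup ↥(maximalRealSubfield L), μω (AdeleRing.ideleBaseChange (↥(maximalRealSubfield L)) L x) = quadraticHeckeCharCM L x) →
    letI : ∀ v : HeightOneSpectrum (𝓞 ↥(maximalRealSubfield L)), MeasurableSpace ((cmDatum L 3 H).Local v) := fun _ => borel _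
    letI : ∀ v : HeightOneSpectrum (𝓞 ↥(maximalRealSubfield L)),
        MeasurableSpace ((cmDatum L 2 (Matrix.of fun i j : Fin 2 => if i.val + j.val + 1 = 2 then (1 : L) else 0)).Local v ×
          (cmDatum L 1 (Matrix.of fun i j : Fin 1 => if i.val + j.val + 1 = 1 then (1 : L) else 0)).Local v) := fun _ => borel _
    letI : ∀ (v : HeightOneSpectrum (𝓞 ↥(maximalRealSubfield L)))
        (a : ((cmDatum L 2 (Matrix.of fun i j : Fin 2 => if i.val + j.val + 1 = 2 then (1 : L) else 0)).Local v ×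
          (cmDatum L 1 (Matrix.of fun i j : Fin 1 => if i.val + j.val + 1 = 1 then (1 : L) else 0)).Local v)),
        MeasurableSpace (((cmDatum L 2 (Matrix.of fun i j : Fin 2 => if i.val + j.val + 1 = 2 then (1 : L) else 0)).Local v ×
            (cmDatum L 1 (Matrix.of fun i j : Fin 1 => if i.val + j.val + 1 = 1 then (1 : L) else 0)).Local v) ⧸
          Subgroup.centralizer ({a} : Set ((cmDatum L 2 (Matrix.of fun i j : Fin 2 => if i.val + j.val + 1 = 2 then (1 : L) else 0)).Local v ×
            (cmDatum L 1 (Matrix.of fun i j : Fin 1 => if i.val + j.val + 1 = 1 then (1 : L) else 0)).Local v))) := fun _ _ => borel _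
    letI : ∀ (v : HeightOneSpectrum (𝓞 ↥(maximalRealSubfield L))) (γ : (cmDatum L 3 H).Local v),
        MeasurableSpace ((cmDatum L 3 H).Local v ⧸ Subgroup.centralizer ({γ} : Set ((cmDatum L 3 H).Local v))) := fun _ _ => borel _
    letI : ∀ v : HeightOneSpectrum (𝓞 ↥(maximalRealSubfield L)), MeasurableSpace (Gqs L v ⧸ Subgroup.center (Gqs L v)) := fun _ => borel _
    ∃ (Δ : ∀ v : HeightOneSpectrum (𝓞 ↥(maximalRealSubfield L)), LocalTransferFactor L H v)
      (mH : ∀ v : HeightOneSpectrum (𝓞 ↥(maximalRealSubfield L)),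
    OrbitalMeasureFamily ((cmDatum L 2 (Matrix.of fun i j : Fin 2 => if i.val + j.val + 1 = 2 then (1 : L) else 0)).Local v ×
      (cmDatum L 1 (Matrix.of fun i j : Fin 1 => if i.val + j.val + 1 = 1 then (1 : L) else 0)).Local v))
      (mG : ∀ v : HeightOneSpectrum (𝓞 ↥(maximalRealSubfield L)), OrbitalMeasureFamily ((cmDatum L 3 H).Local v))
      (νG : ∀ v : HeightOneSpectrum (𝓞 ↥(maximalRealSubfield L)), Measure ((cmDatum L 3 H).Local v))
      (νH : ∀ v : HeightOneSpectrum (𝓞 ↥(maximalRealSubfield L)),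
    Measure ((cmDatum L 2 (Matrix.of fun i j : Fin 2 => if i.val + j.val + 1 = 2 then (1 : L) else 0)).Local v ×
      (cmDatum L 1 (Matrix.of fun i j : Fin 1 => if i.val + j.val + 1 = 1 then (1 : L) else 0)).Local v))
      (ξloc : OneDimAutRepH L → ∀ v : HeightOneSpectrum (𝓞 ↥(maximalRealSubfield L)),
    (cmDatum L 2 (Matrix.of fun i j : Fin 2 => if i.val + j.val + 1 = 2 then (1 : L) else 0)).Local v ×
      (cmDatum L 1 (Matrix.of fun i j : Fin 1 => if i.val + j.val + 1 = 1 then (1 : L) else 0)).Local v →* ℂˣ)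
      (μZ : ∀ v : HeightOneSpectrum (𝓞 ↥(maximalRealSubfield L)), Measure (Gqs L v ⧸ Subgroup.center (Gqs L v)))
      (keys : ∀ (ξ : OneDimAutRepH L) (v : HeightOneSpectrum (𝓞 ↥(maximalRealSubfield L))),
    (∀ w : PlacesOver L v, IsCMField.complexConj L • w.1 = w.1) →
      {p : IrrClass (Gqs L v) × IrrClass (Gqs L v) //
        KeysCaseTwoLabels L v (μω.semilocalComponent L v) (torusLocalComponent L (IsCMField.complexConj L) v ξ.η)
          (torusLocalComponent L (IsCMField.complexConj L) v ξ.ψ) p.1 p.2 ∧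
        p.1.IsSquareIntegrable (μZ v) ∧ ¬ p.2.IsSquareIntegrable (μZ v)})
      (hCM : ∀ (ξ : OneDimAutRepH L) (v : HeightOneSpectrum (𝓞 ↥(maximalRealSubfield L)))
    (hns : ∀ w : PlacesOver L v, IsCMField.complexConj L • w.1 = w.1)
    (T : GL (Fin 3) (LocalRing L v)) (a : LocalRing L v) (ha : IsUnit a)
    (h : formCongr (conjLocal L (IsCMField.complexConj L) v) T (H.map (algebraMap L (LocalRing L v))) =
      a • (Matrix.of fun i j : Fin 3 => if i.val + j.val + 1 = 3 then (1 : L) else 0).map (algebraMap L (LocalRing L v)))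
    (π2 πn : IrrClass (Gqs L v)),
    KeysCaseTwoLabels L v (μω.semilocalComponent L v) (torusLocalComponent L (IsCMField.complexConj L) v ξ.η)
      (torusLocalComponent L (IsCMField.complexConj L) v ξ.ψ) π2 πn → ¬ πn.IsSquareIntegrable (μZ v) →
    CMNonsplitCharIdentityAt L v H (Δ v) (mH v) (mG v) (νG v) (νH v) (ξloc ξ v) (IrrClass.comap (cmDatumLocalCongr L v T ha h).symm πn))
      (_hHaar : ∀ v : HeightOneSpectrum (𝓞 ↥(maximalRealSubfield L)), (μZ v).IsHaarMeasure),
      -- DOCK: the theta-docking clause for every theta frame and every one-dimensional automorphic `ξ`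
      (∀ {n' : ℕ} (e₁ : Fin 3 × Fin 1 ≃ Fin n') (dV : Fin 3 → L) (hdV : ∀ i, IsCMField.complexConj L (dV i) = dV i) (hdV0 : ∀ i, dV i ≠ 0) (g : GL (Fin 3) L)
          (hg : ((g : Matrix (Fin 3) (Fin 3) L).map (cmConjRingHom L))ᵀ * H * (g : Matrix (Fin 3) (Fin 3) L) = Matrix.diagonal dV) (ξ : OneDimAutRepH L),
          CMThetaDockingClauses L H Δ mH mG νH νG ξ μω (ξloc ξ) e₁ dV hdV hdV0 g hg) ∧
      -- MEM: every local constituent class of a cotangent `P`'s finite component at a non-split `v` is a member of the packet of record of its `ξ`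
      (∀ (μ : Measure (adelicGroupData (↥(maximalRealSubfield L)) L (IsCMField.complexConj L) 3 H).automorphicQuotient)
          [(adelicGroupData (↥(maximalRealSubfield L)) L (IsCMField.complexConj L) 3 H).IsAutomorphicMeasure μ]
          (W : Type) [AddCommGroup W] [Module ℂ W]
          (σ : Representation ℂ (finAdelic (↥(maximalRealSubfield L)) L (IsCMField.complexConj L) 3 H) W),
          σ.IsIrreducible → σ.IsSmooth → σ.IsAdmissible →
        ∀ (P : DiscreteAutomorphicRep (adelicGroupData (↥(maximalRealSubfield L)) L (IsCMField.complexConj L) 3 H) μ),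
          (P.IsHolCotangentAt (cmArchSection L ι H T hT) (cmCompactFactor L ι H T hT) ∨
            P.IsAntiholCotangentAt (cmArchSection L ι H T hT) (cmCompactFactor L ι H T hT)) →
          P.HasFinComponent σ →
        ∀ (ξ : OneDimAutRepH L),
          MemXiFamily P (transpose_map_cmConjRingHom_eq_of_frame L ι H T hT) (isUnit_det_of_frame L ι H T hT) μω hμu ξ →
        ∀ (v : HeightOneSpectrum (𝓞 ↥(maximalRealSubfield L))),
          (∀ w : PlacesOver L v, IsCMField.complexConj L • w.1 = w.1) →
          ∀ c : IrrClass ((cmDatum L 3 H).Local v),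
            (IrrClass.comap (localPiEquiv L (IsCMField.complexConj L) 3 H v) c).IsConstituentOf
                (σ.comp (inclPlace (↥(maximalRealSubfield L)) L (IsCMField.complexConj L) 3 H v)) →
            c ∈ (F0P3XiPacketFamilyOfRecord.xiPacketFamilyOfRecord L H (transpose_map_cmConjRingHom_eq_of_frame L ι H T hT)
              (isUnit_det_of_frame L ι H T hT) μω hμu Δ mH mG νG νH ξloc μZ keys hCM ξ v).members)

set_option synthInstance.maxHeartbeats 400000 in
set_option maxHeartbeats 8000000 in
/-- **C2♯ — LOCAL PLACEHOLDER TYPE of P3's letter `cohDiscrete_memXiFamily_archPinned`** (director s528 (2)(a); TEXT = conjunct (C2♯) of P3's T5 v4 head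
`F0T5InnerFormClassification.shapeGuarded_of_T5` (tree commit 9a790d6ced2e, :1179 ff.) VERBATIM under S2♭'s frame binders, per F0P3-plan's x-post P2 10:16:00Z): for a
cotangent discrete `P` on which `cmCompactFactor` acts trivially and whose `(𝔤,K)`-module at `ι` carries a `(1,±1)` token, some one-dimensional automorphic `ξ` has `P` in
its ξ-local family AND `ξ_∞` is cohomologically trivial at `tOfArchType k ι'` for EVERY unitary archimedean type `(k,0)` of `μω`.  Registered stub `stub_S2sharp : C2SharpLetter`;
at landing the TYPE becomes P3's FQN (one token).  The head consumes the convenient shape `S2SharpExport` through the adapter `s2SharpExport_of_C2sharp` below.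
(print: Rogawski1990, Thm. 13.3.6 (c); Thm. 14.6.4; Prop. 15.2.1 (b); §12.3 p. 178; §15.3 ¶1) -/
def C2SharpLetter : Prop :=
  ∀ (L : Type) [Field L] [NumberField L] [IsCMField L] (ι : L →+* ℂ) (H : Matrix (Fin 3) (Fin 3) L) (T : GL (Fin 3) ℂ)
    (hT : (T : Matrix (Fin 3) (Fin 3) ℂ)ᴴ * H.map ι * (T : Matrix (Fin 3) (Fin 3) ℂ) = Literature.Geometry.ComplexHyperbolic.BallModel.J),
    (∀ τ' : L →+* ℂ, InfinitePlace.mk τ' ≠ InfinitePlace.mk ι → (H.map τ').PosDef) →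
    2 ≤ Module.finrank ℚ ↥(maximalRealSubfield L) →
    ∀ (μ : Measure (adelicGroupData (↥(maximalRealSubfield L)) L (IsCMField.complexConj L) 3 H).automorphicQuotient)
      [(adelicGroupData (↥(maximalRealSubfield L)) L (IsCMField.complexConj L) 3 H).IsAutomorphicMeasure μ]
      (μω : HeckeCharacter L) (hμu : μω.IsUnitary),
      (∀ x : Literature.NumberTheory.GaloisRepresentations.ideleGroup ↥(maximalRealSubfield L),
        μω (AdeleRing.ideleBaseChange (↥(maximalRealSubfield L)) L x) = quadraticHeckeCharCM L x) →
    ∀ (P : DiscreteAutomorphicRep (adelicGroupData (↥(maximalRealSubfield L)) L (IsCMField.complexConj L) 3 H) μ),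
          (P.IsHolCotangentAt (cmArchSection L ι H T hT) (cmCompactFactor L ι H T hT) ∨
            P.IsAntiholCotangentAt (cmArchSection L ι H T hT) (cmCompactFactor L ι H T hT)) →
          (∀ k : (adelicGroupData (↥(maximalRealSubfield L)) L (IsCMField.complexConj L) 3 H).Adelic, k ∈ cmCompactFactor L ι H T hT → ∀ v : P.space.toSubmodule, (adelicGroupData (↥(maximalRealSubfield L)) L (IsCMField.complexConj L) 3 H).rightRegular μ k (v : (adelicGroupData (↥(maximalRealSubfield L)) L (IsCMField.complexConj L) 3 H).L2 μ) = v) → ∀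
          (M : Type) [AddCommGroup M] [Module ℂ M]
          (σK : Representation ℂ (uFormGroup (Fin 2) (Fin 1)).maximalCompact M) (σ𝔤 : (uFormGroup (Fin 2) (Fin 1)).lie →ₗ⁅ℝ⁆ Module.End ℂ M)
          (hM : IsGKModule (uFormGroup (Fin 2) (Fin 1)) σK σ𝔤), IsIrreducibleGK σK σ𝔤 →
          (∃ T₁ : P.archModuleCM ι T hT →ₗ[ℂ] M,
            (∀ (k : (uFormGroup (Fin 2) (Fin 1)).maximalCompact) (w : P.archModuleCM ι T hT), T₁ (P.archRepKCM ι T hT k w) = σK k (T₁ w)) ∧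
              (∀ (X : (uFormGroup (Fin 2) (Fin 1)).lie) (w : P.archModuleCM ι T hT), T₁ (P.archRepLieCM ι T hT X w) = σ𝔤 X (T₁ w)) ∧ T₁ ≠ 0) →
          ∀ δ : ℤ, (δ = 1 ∨ δ = -1) → upqTypeClasses σK σ𝔤 hM.ad_compat 1 δ ≠ ⊥ →
            ∃ ξ : OneDimAutRepH L, MemXiFamily P (transpose_map_cmConjRingHom_eq_of_frame L ι H T hT) (isUnit_det_of_frame L ι H T hT) μω hμu ξ ∧
              ∀ k : InfinitePlace L → ℤ, μω.HasUnitaryArchType k (fun _ => 0) → ∀ ι' : L →+* ℂ, ξ.IsCohTrivialAt (ArchSignRecipe.tOfArchType k ι') ι'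

set_option synthInstance.maxHeartbeats 400000 in
set_option maxHeartbeats 8000000 in
/-- **S2♯ EXPORT SHAPE (this file's internal currency; P2 desk 09:36:46Z VERBATIM) — PROVED from `C2SharpLetter` by `s2SharpExport_of_C2sharp`:**
for a COTANGENT discrete `P` of `U(H)` (hol ∨ antihol at `ι`, trivial on the compact factor — B0's binder) there is a one-dimensional automorphic `ξ` of
`U(2)×U(1)` with `P` in the ξ-local family (★ D6 `MemXiFamily`, finite places) AND an archimedean pin of `ξ_∞` against `μω`'s type `k` (★ `XiArchPinned`,
p818382).  Frame binders = S2♭'s (★ `cohDiscrete_memXiFamily`) up to `hquad`.  Replaced by `import` + P3's FQN the hour the letter lands ★ (one-token rename of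
`stub_S2sharp`'s type; if P3's body is this text the head is unchanged). (print: Rogawski1990, Thm. 13.3.6 (c); Thm. 14.6.4; Prop. 15.2.1 (b); §12.3 p. 178; §14.6 p. 241) -/
def S2SharpExport : Prop :=
  ∀ (L : Type) [Field L] [NumberField L] [IsCMField L] (ι : L →+* ℂ) (H : Matrix (Fin 3) (Fin 3) L) (T : GL (Fin 3) ℂ)
    (hT : (T : Matrix (Fin 3) (Fin 3) ℂ)ᴴ * H.map ι * (T : Matrix (Fin 3) (Fin 3) ℂ) = Literature.Geometry.ComplexHyperbolic.BallModel.J),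
    (∀ τ' : L →+* ℂ, InfinitePlace.mk τ' ≠ InfinitePlace.mk ι → (H.map τ').PosDef) →
    2 ≤ Module.finrank ℚ ↥(maximalRealSubfield L) →
    ∀ (μ : Measure (adelicGroupData (↥(maximalRealSubfield L)) L (IsCMField.complexConj L) 3 H).automorphicQuotient)
      [(adelicGroupData (↥(maximalRealSubfield L)) L (IsCMField.complexConj L) 3 H).IsAutomorphicMeasure μ]
      (μω : HeckeCharacter L) (hμu : μω.IsUnitary),
      (∀ x : Literature.NumberTheory.GaloisRepresentations.ideleGroup ↥(maximalRealSubfield L),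
        μω (AdeleRing.ideleBaseChange (↥(maximalRealSubfield L)) L x) = quadraticHeckeCharCM L x) →
    ∀ (P : DiscreteAutomorphicRep (adelicGroupData (↥(maximalRealSubfield L)) L (IsCMField.complexConj L) 3 H) μ),
      (P.IsHolCotangentAt (cmArchSection L ι H T hT) (cmCompactFactor L ι H T hT) ∨
        P.IsAntiholCotangentAt (cmArchSection L ι H T hT) (cmCompactFactor L ι H T hT)) →
      ∃ (ξ : OneDimAutRepH L) (k : InfinitePlace L → ℤ),
        MemXiFamily P (transpose_map_cmConjRingHom_eq_of_frame L ι H T hT) (isUnit_det_of_frame L ι H T hT) μω hμu ξ ∧ XiArchPinned L ξ μω k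

set_option maxHeartbeats 8000000 in
/-- v1.4 → v1.4b placeholder fidelity: the local `C2SharpLetter` IS P3's letter `cohDiscrete_memXiFamily_archPinned` (F0-typ3 (g6) cert
`F0/P3/typ3/CERT-S2sharp-vs-P2-C2SharpLetter-IffRfl.bypaste.F0-typ3g6.lean`, rc 0); kept so that v1.4's registered text and v1.4b's are visibly the same letter. -/
theorem c2SharpLetter_iff_letter :
    C2SharpLetter ↔ Literature.NumberTheory.Rogawski1990.cohDiscrete_memXiFamily_archPinned :=
  Iff.rfl

set_option synthInstance.maxHeartbeats 400000 in
set_option maxHeartbeats 8000000 in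
/-- **ADAPTER S2♯-export ⟸ C2♯ (6 lines, no `sorry`)**: the `(𝔤,K)`-token of a cotangent `P` is ★ `exists_cohToken_of_isHolOrAntihol_cpt` (F0P3-p03), the
`Kc`-triviality is ★ `cmCompactFactor_rightRegular_eq_self_of_isHolOrAntihol` (p819716), and `μω`'s unitary archimedean type `(k,0)` with every `k_w` ODD is ★
`IsSplittingChar.exists_hasUnitaryArchType` at `m = 1` (`μω|_{𝕀_{L⁺}} = ε_{L/L⁺}` = `hquad`); then `XiArchPinned L ξ μω k = ⟨type, odd, C2♯'s pin at k⟩`.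
(print: Rogawski1990, Prop. 15.2.1 (b)) (print: Liu2021, Remark 4.2) -/
theorem s2SharpExport_of_C2sharp (h : Literature.NumberTheory.Rogawski1990.cohDiscrete_memXiFamily_archPinned) : S2SharpExport := by
  intro L _ _ _ ι H T hT hdef h2 μ _ μω hμu hquad P hP
  obtain ⟨M, iM₁, iM₂, σK, σ𝔤, hM, δ, hδ, hirrGK, hT₁, hne⟩ := exists_cohToken_of_isHolOrAntihol_cpt L ι H T hT μ hdef h2 P hP
  have hKc := F0P3CompactTrivOfRecord.cmCompactFactor_rightRegular_eq_self_of_isHolOrAntihol L ι H T hT P hP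
  obtain ⟨ξ, hmem, hall⟩ := @h L _ _ _ ι H T hT hdef h2 μ _ μω hμu hquad P hP hKc M iM₁ iM₂ σK σ𝔤 hM hirrGK hT₁ δ hδ hne
  have hs : HarrisKudlaSweet1996.IsSplittingChar L 1 μω := (HarrisKudlaSweet1996.isSplittingChar_iff_of_odd odd_one μω).2 hquad
  obtain ⟨e, he, hmod⟩ := hs.exists_hasUnitaryArchType hμu
  have hodd : ∀ w : InfinitePlace L, Odd (e w) := fun w => Int.odd_iff.2 (by simpa [Int.ModEq] using hmod w)
  exact ⟨ξ, e, hmem, he, hodd, hall e he⟩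

/-! ## §2 The registered stubs (sorries live ONLY here) and the delta-alias of the concluded node -/

/-- delta-alias of PKΠ (only `stubPKPi_of_rung4_stubs` concludes `PKPiTarget` BY NAME; the head concludes this alias). -/
def PKPiRecorded : Prop :=
  PKPiTarget

/-- **stub S2♯ (PRINT-DERIVED, P3-owned letter BY NAME `Literature.NumberTheory.Rogawski1990.cohDiscrete_memXiFamily_archPinned` — director s528 (2)(a), s532; v1.4b)** —
«a cotangent discrete `P` lies in the ξ-local family of a one-dimensional automorphic `ξ`, with `ξ_∞` pinned against `μω`'s type».
[cite: Rogawski1990, Thm. 13.3.6 (c); Thm. 14.6.4; Prop. 15.2.1 (b); §12.3 p. 178; §14.6 p. 241] -/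
theorem stub_S2sharp : Literature.NumberTheory.Rogawski1990.cohDiscrete_memXiFamily_archPinned := by
  sorry

/-! ### v1.5 «GR91N FOLD»: letter #76 `GR91Lemma512NonsplitAsPrinted` (registered v1.4, row U′-N, director s515 (2)) — Gelbart–Rogawski's Lemma 5.1.2 at NON-SPLIT
places — is now DERIVED: three print letters by name + the ★ twin.  [cite: GelbartRogawski1991, §5.1 (5.1.1), Lem. 5.1.2 p. 466] [cite: Rogawski1990, §12.2 (2) p. 174] -/

set_option synthInstance.maxHeartbeats 400000 in
set_option maxHeartbeats 16000000 in
open NumberField IsDedekindDomain MeasureTheory Literature.NumberTheory Literature.NumberTheory.Automorphic Literature.NumberTheory.Automorphic.UnitaryGroup Literature.NumberTheory.Automorphic.IdeleClassGroup Literature.NumberTheory.Automorphic.Liu2021 Literature.NumberTheory.Automorphic.Liu2021.Def411WeilCarriers Literature.NumberTheory.Automorphic.Liu2021.Def411WeilCarriersDoubling Literature.NumberTheory.GelbartRogawski1991.UnitaryDualPair Literature.NumberTheory.GelbartRogawski1991.UnitaryDualPair.WeilCoinv Literature.RepresentationTheory.Liu2021 Literature.NumberTheory.GaloisRepresentations Literature.NumberTheory.Rogawski1990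 Literature.NumberTheory.GelbartRogawski1991 Literature.RepresentationTheory Summit.HodgeConjecture.HodgeConjecture.Cruxes.H413.F0P2oN3TorusWeightOfD3d in
/-- **N3 (D) — the torus weight on the Jacquet module, ∀-closed — ★ CLOSED BY NAME** over A-p16 (g24)՚s (5c) ★ p836093 `F0P2oN3TorusWeightHolds.forall_jacquetModule_xThetaGqsCM_torus_eq_smul` (over (5b) ★ p835944 + the (D3d) bricks; edition v1.12; no `sorry`): «the diagonal torus element `m(γ) = d(γ, 1, γ̄⁻¹)` (`torusEntry … 1 t = 1`) acts on
`r_N(X_v(μ, ε, χ_f))` by `μ_w(γ)·‖γ‖_w^{1/2}` (`(toHeckeCharacter L μ).semilocalComponent L v γ * halfModulusChar _ γ`)» [Kudla1986 Thm. 2.8; Rogawski1990 §12.2 (2) p. 174; GelbartRogawski1991 §3.2 (3.2.2)].  TEXT = the binder `hD`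
of ★ p835661 TOKEN FOR TOKEN (tree lines :101–:117).  In-house road (D): A-p16 (g24)՚s (5b) CM-package wrapper `Theorems/F0P2oThetaJacquetTorusWeight.lean` ⇒ ★ `F0P2oN3TorusWeightOfD3d.thetaType_nonsplit_jacquetModule_b_of_kerWeight`. -/
theorem stub_N3D_letter :
    ∀ (L : Type) [Field L] [NumberField L] [IsCMField L]
      {n' : ℕ} (e₁ : Fin 3 × Fin 1 ≃ Fin n') (dV : Fin 3 → L) (hdV : ∀ i, IsCMField.complexConj L (dV i) = dV i) (hdV0 : ∀ i, dV i ≠ 0)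
      (μ : Literature.NumberTheory.Automorphic.IdeleClassGroup L →ₜ* Circle) (hμ : IsConjugateSymplectic L μ)
      (χf : UnitaryGroup.finAdelicOne (↥(maximalRealSubfield L)) L (IsCMField.complexConj L) →* ℂˣ),
      Continuous χf → (∀ z, ‖((χf z : ℂˣ) : ℂ)‖ = 1) →
      ∀ (v : HeightOneSpectrum (𝓞 ↥(maximalRealSubfield L))),
        (∀ w : PlacesOver L v, IsCMField.complexConj L • w.1 = w.1) →
        ∀ (ε : (↥(maximalRealSubfield L))ˣ)
          (T : GL (Fin 3) (UnitaryGroup.LocalRing L v)) (a : UnitaryGroup.LocalRing L v) (ha : IsUnit a)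
          (h : formCongr (conjLocal L (IsCMField.complexConj L) v) T ((Matrix.diagonal dV).map (algebraMap L (UnitaryGroup.LocalRing L v))) =
            a • (Matrix.of fun i j : Fin 3 => if i.val + j.val + 1 = 3 then (1 : L) else 0).map (algebraMap L (UnitaryGroup.LocalRing L v)))
          (t : ↥(cmBorelTriple L 3 v).M),
          torusEntry (conjLocal L (IsCMField.complexConj L) v) (cmLocalForm L 3 v) 1 t = 1 →
          ∀ x : ((cmBorelTriple L 3 v).restrict (xThetaGqsCM L e₁ dV hdV hdV0 μ hμ χf ε v T ha h)).Coinvariants,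
            Representation.jacquetModule (xThetaGqsCM L e₁ dV hdV hdV0 μ hμ χf ε v T ha h) (cmBorelTriple L 3 v) t x =
              (((toHeckeCharacter L μ).semilocalComponent L v (torusEntry (conjLocal L (IsCMField.complexConj L) v) (cmLocalForm L 3 v) 0 t) *
                  halfModulusChar (UnitaryGroup.LocalRing L v) (torusEntry (conjLocal L (IsCMField.complexConj L) v) (cmLocalForm L 3 v) 0 t) : ℂˣ) : ℂ) • x :=
  Summit.HodgeConjecture.HodgeConjecture.Cruxes.H413.F0P2oN3TorusWeightHolds.forall_jacquetModule_xThetaGqsCM_torus_eq_smul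

/-- **THE N3 LETTER — ★ CLOSED BY NAME, HYPOTHESIS-FREE** (edition v1.13 «N3 DIRECT FOLD» over ★ p839151 F0P2-p06 (g4) `Theorems/F0P2oLineJacquetHolds.lean :: thetaType_nonsplit_jacquetModule_holds` (the (JA) junction over ★ (C5) p838835 B-p10 (g23), ★ (C6)∕(J1)–(J4) p838314 B-p14 (g29) + `F0P2oLineJacquetReindex`, ★ (BE) p838099∕p838184 B-p18 (g29), ★ (N′) p837961 F0P2-p06 (g4), ★ (LS) p836839, ★ (LM) p836568, ★ (FX)(CC) p837171∕p837965, ★ (BF) p837182, ★ (BD) p838316, ★ (IB) p838392, ★ (KL) p838305, ★ (SJ-gen) p838357; lead B-p18 (g29) socket (B) word 2026-08-31T23:47:37Z) — the η-free (N′) line-Jacquet road; the clause-(a) stub `stub_N3a_letter` of v1.12 is DROPPED, `stub_N3D_letter` stays ★ by name; WAS: (D) proved in tree; edition v1.12 over ★ p835661 `F0P2oN3OfTorusWeight.thetaType_nonsplit_jacquetModule_of_a_of_torusWeight stub_N3a_letter stub_N3D_letter`; the whole letter was a print letter by name before) — (edition v1.5; row #96): [GelbartRogawski1991 §3.2 (3.2.1)–(3.2.2)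 p. 457; Kudla1986 Thm. 2.8] — the Jacquet module of the local theta
type at a non-split place, ★-typed p826177 (typ-T7a (g0)) `Literature/NumberTheory/GelbartRogawski1991/ThetaTypeNonsplitJacquetModule.lean`. Statement unchanged; no `sorry`. -/
theorem stub_N3_letter : Literature.NumberTheory.GelbartRogawski1991.thetaType_nonsplit_jacquetModule :=
  Summit.HodgeConjecture.HodgeConjecture.Cruxes.H413.F0P2oLineJacquetHolds.thetaType_nonsplit_jacquetModule_holds

/-- **THE K1w LETTER — ★ CLOSED BY NAME, HYPOTHESIS-FREE (edition v1.11 over ★ p833012 `F0P2pK1wHolds.cmPrincipalSeries_isConstituentOf_weylConj_holds`; was over N1 at v1.10)** (row #98): [Rogawski1990 §12.1 p. 172, §12.2 p. 174; BernsteinZelevinsky1977 Thm. 2.9] —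
«`JH(i_G(χ)) = JH(i_G(wχ))`» for the quasi-split `U(3)` principal series, ★-typed p826332 (typ-T7a (g0)) `Literature/NumberTheory/Rogawski1990/U3PrincipalSeriesWeylConjugate.lean`,
PROVED IN-HOUSE modulo the one print letter N1 by F0P2-p06 (g0)'s K1w pay-down chain ★ F1 p827152 · F2 p828054 · F3a p828055 · F3b p828796 · F4a p829088 · F4b p829948 ·
F4c p832032 `F0P2pK1wLetterOfN1.cmPrincipalSeries_isConstituentOf_weylConj_of_N1 (hN1)` (N6 discharged inside by ★ p831380; twin B-p17 (g21); ref1 r187 (2)).  Statement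
unchanged (the letter BY NAME); no `sorry`. -/
theorem stub_K1w_letter : Literature.NumberTheory.Rogawski1990.cmPrincipalSeries_isConstituentOf_weylConj :=
  Summit.HodgeConjecture.HodgeConjecture.Cruxes.H413.F0P2pK1wHolds.cmPrincipalSeries_isConstituentOf_weylConj_holds

/-- **THE U1 LETTER — ★ CLOSED BY NAME MODULO N3 ONLY (edition v1.11 over ★ p833094 `F0P2pGR91NOfN3.u1ThetaDichotomy_nonsplit_of_N3 stub_N3_letter`; was over N3 + N1 at v1.10)** (row #97): [HarrisKudlaSweet1996 Cor. 4.4 p. 962; Rogawski1992 Prop. 3.4] — the `(U(1),U(1))` theta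
dichotomy at a non-split place in CM normalisation, ★-typed p826953∕ED. 2 p827180 (typ-T7b (g0)) `Literature/NumberTheory/GelbartRogawski1991/U1ThetaDichotomy.lean`,
PROVED IN-HOUSE «up the tower» modulo the print letters N3 and N1: ★ p829230 B-p18 (g28) `F0P2oU1LetterOfTower.u1ThetaDichotomy_nonsplit_of_uniqueSub (hN3) (h4)`
(road (T): ★ p828521 U1-DISJOINT of tower, ★ p828329 A-p12 (g16) dichotomy of disjoint, ★ p829029 step (1), ★ p829024 F0P2-p05 (g0) step (5)) with ‹h4› = the CM HEAD
★ p832406 B-p18 (g28) `F0P2pPrincipalSeriesUniqueSubCM.principalSeries_uniqueSub (hN1)` («at most one irreducible subrepresentation of `i_G(χ)`, `χ ≠ wχ`»;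
★ p831178 F0P2-p02 (g6) generic `areIsomorphicRep_of_intertwiningMap_normalizedInd_ne_zero` + ★ p831282 F0P2-p06 (g0) N1 unfold; [Casselman1995 Lemma 7.1.1 (a), Thm. 6.3.5;
BernsteinZelevinsky1977 Prop. 1.9, Thm. 2.4 (b); Rogawski1990 §12.2 pp. 173–174]).  Statement unchanged (the letter BY NAME); no `sorry`. -/
theorem stub_U1_letter : Literature.NumberTheory.GelbartRogawski1991.u1ThetaDichotomy_nonsplit :=
  Summit.HodgeConjecture.HodgeConjecture.Cruxes.H413.F0P2pGR91NOfN3.u1ThetaDichotomy_nonsplit_of_N3 stub_N3_letter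

/-- **stub GR91N — ★ CLOSED BY NAME (edition v1.5)** over the Lines-free twin `F0P2oGR91NOfLetters.GR91N_of_letters` of the pay-down line
`Cruxes/H413/Lines/F0_P2GR91NJacquet.lean` (K1 ★ p828142 + K2 ★ p826011): letter #76 is a kernel consequence of the three print letters above. -/
theorem stub_GR91N : Literature.NumberTheory.GelbartRogawski1991.GR91Lemma512NonsplitAsPrinted :=
  Summit.HodgeConjecture.HodgeConjecture.Cruxes.H413.F0P2pGR91NOfN3.GR91Lemma512NonsplitAsPrinted_of_N3 stub_N3_letter

/-- **THE N6 PRINT LETTER BY NAME** (v1.7): [GetzHahn2024 Thm. 8.3.3; Rogawski1990 §12.2 p. 173; BernsteinZelevinsky1976 Thm. 3.21] — ★-typed p826085 (typ-T7a (g0));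
★ CLOSED BY NAME at v1.8 over `u3_isSupercuspidal_iff_jacquet_eq_zero_holds` (p831380, A-p16 (g23) over B-p17 (g21) (δ)). No `sorry`. -/
theorem stub_N6_letter : Literature.NumberTheory.Rogawski1990.u3_isSupercuspidal_iff_jacquet_eq_zero :=
  Literature.NumberTheory.Rogawski1990.u3_isSupercuspidal_iff_jacquet_eq_zero_holds

/-- **THE N7 LETTER — ★ CLOSED BY NAME, HYPOTHESIS-FREE** (edition v1.12 «N7 FOLD» over ★ p835805 A-p13 (g27) `F0P2oN7OfCasselmanCriterion.u3_squareIntegrable_jacquetExponent_decay_holds` — Casselman՚s criterion ⇒ over #109 N5 ★ p834912; books #110 −1 at this REGISTERED edition; row N7, a print letter by name before): [Casselman1995 Thm. 4.4.6 (⇒), as restated in KatoTakano2009 p. 3; Rogawski1990 §12.2 (2) pp. 173–174] — Casselman's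
square-integrability criterion for the quasi-split `U(3)` at a non-split place (Borel–Jacquet quotient exponents of a square-integrable representation decay on the
dominant cone), ★-typed by typ-T7b (g0): `Literature/NumberTheory/Rogawski1990/U3SquareIntegrabilityExponentCriterion.lean` (`def … : Prop`). Statement unchanged; no `sorry`. -/
theorem stub_N7_letter : Literature.NumberTheory.Rogawski1990.u3_squareIntegrable_jacquetExponent_decay :=
  Summit.HodgeConjecture.HodgeConjecture.Cruxes.H413.F0P2oN7OfCasselmanCriterion.u3_squareIntegrable_jacquetExponent_decay_holds

set_option synthInstance.maxHeartbeats 400000 in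
set_option maxHeartbeats 8000000 in
/-- **LABEL — ★ CLOSED BY NAME (v1.9; ENGINE at v1.7)** — «the theta type of an OCCURRING class is not square-integrable modulo the centre»: the `hL` binder of the ★ twin
`xiLocalPacket_nonsplit_isThetaPair_of_letters` VERBATIM, now proved over ★ p831648 B-p18 (g28) `F0P2oThetaTypeNotL2.thetaType_not_squareIntegrable (hN3) (hN6) (hN7)`.
(print: Rogawski1990, §12.2 (2) p. 174) (print: Casselman1995, Thm. 4.4.6) -/
theorem stub_LABEL :
      ∀ (L : Type) [Field L] [NumberField L] [IsCMField L] (H : Matrix (Fin 3) (Fin 3) L) (hH : (H.map (cmConjRingHom L))ᵀ = H) (hHd : IsUnit H.det)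
        {n' : ℕ} (e₁ : Fin 3 × Fin 1 ≃ Fin n') (dV : Fin 3 → L) (hdV : ∀ i, IsCMField.complexConj L (dV i) = dV i) (hdV0 : ∀ i, dV i ≠ 0) (g : GL (Fin 3) L)
        (hg : ((g : Matrix (Fin 3) (Fin 3) L).map (cmConjRingHom L))ᵀ * H * (g : Matrix (Fin 3) (Fin 3) L) = Matrix.diagonal dV),
        ∀ (μ : Literature.NumberTheory.Automorphic.IdeleClassGroup L →ₜ* Circle) (hμ : IsConjugateSymplectic L μ)
          (χf : UnitaryGroup.finAdelicOne (↥(maximalRealSubfield L)) L (IsCMField.complexConj L) →* ℂˣ),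
          Continuous χf → (∀ z, ‖((χf z : ℂˣ) : ℂ)‖ = 1) →
          ∀ (v : HeightOneSpectrum (𝓞 ↥(maximalRealSubfield L))),
            (∀ w : PlacesOver L v, IsCMField.complexConj L • w.1 = w.1) →
            ∀ (T : GL (Fin 3) (UnitaryGroup.LocalRing L v)) (a : UnitaryGroup.LocalRing L v) (ha : IsUnit a)
              (h : formCongr (conjLocal L (IsCMField.complexConj L) v) T (H.map (algebraMap L (UnitaryGroup.LocalRing L v))) =
                a • (Matrix.of fun i j : Fin 3 => if i.val + j.val + 1 = 3 then (1 : L) else 0).map (algebraMap L (UnitaryGroup.LocalRing L v)))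
              (ε : (↥(maximalRealSubfield L))ˣ) (x₀ : IrrClass (Gqs L v)) (ψθ : ↥(normOneUnits (conjLocal L (IsCMField.complexConj L) v)) →* ℂˣ),
              IsThetaCenterChar L μ χf ε v ψθ →
              x₀.IsConstituentOf (cmPrincipalSeries L 3 v (cmXiTorusChar L v ((toHeckeCharacter L μ).semilocalComponent L v) ψθ⁻¹ ψθ)) →
              ThetaTypeAtCM L H e₁ dV hdV hdV0 g hg μ hμ χf ε v (IrrClass.comap (cmDatumLocalCongr L v T ha h).symm x₀) →
              ∀ [MeasurableSpace (Gqs L v ⧸ Subgroup.center (Gqs L v))] [BorelSpace (Gqs L v ⧸ Subgroup.center (Gqs L v))]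
                (μZ : Measure (Gqs L v ⧸ Subgroup.center (Gqs L v))) [μZ.IsHaarMeasure], ¬ x₀.IsSquareIntegrable μZ :=
  Summit.HodgeConjecture.HodgeConjecture.Cruxes.H413.F0P2oThetaTypeNotL2.thetaType_not_squareIntegrable stub_N3_letter stub_N6_letter stub_N7_letter

/-- **#75-loc BY NAME over the ★ twin** (v1.7; no `sorry` in this declaration): the local theta dichotomy for the true packet from this file's own letter stubs. -/
theorem xiLocalPacket_nonsplit_isThetaPair_of_stubs : Literature.NumberTheory.GelbartRogawski1991.xiLocalPacket_nonsplit_isThetaPair :=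
  Summit.HodgeConjecture.HodgeConjecture.Cruxes.H413.F0P2oXiLocalPacketThetaPairOfLetters.xiLocalPacket_nonsplit_isThetaPair_of_letters
    stub_N3_letter stub_K1w_letter stub_U1_letter stub_N6_letter stub_LABEL

/-- **stub D7α PER MEASURE ON TEST FUNCTIONS, WEIGHT-ONE AUTOMORPHIC LOCUS, BY NAME (v1.16 «DOCK-TW1»; replaces v1.15՚s `stub_D7αMemDockμT : …StubD7αMemDockPerMeasureT`, which is WEAKENED
to the W1 node ★ p849450 `StubD7αMemDockPerMeasureTW1` — DOCKᵀ ↦ DOCKᵀ-W1 ★ p848882 `CMThetaDockingClausesTestW1`, i.e. the dock tested only against pairs `(μ, χ_f)` with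
`HasWeight L μ 1` and `IsAutomorphicOneChar … χ_f`; SHAPE∕MEM unchanged; weaker by the in-file sorry-free probe `stubD7αMemDockPerMeasureTW1_of_T`)** —
`∀ frame μ, ∃ (Δ mH mG νG νH ξloc μZ) (packFin) (_hHaar) (_hνG), DOCKᵀ-W1 ∧ SHAPE ∧ MEM_μ`; discharge road (LEAD F0P3a-plan (g13) T12-28 (w-c)): ★ p849516
`F0P2oD7alphaMemDockOfRowsSCDSignedW1.stubD7αMemDockPerMeasureTW1_of_rowsSCDSigned` ∘ closer rows ∘ LH10 `Db_T_paidW1` (leaf `Cruxes/H413/Lines/F0_P3c_DbTPaydown.lean` ED. 5-W; its O1-W1 organ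
is ★-closed in-house, residue O2♭ [Rogawski1990 Thm. 13.3.6 (c)] print), `Δ := Δ° = ε_v(H)•Δ‴`; road-S fallback ★ p848524 + `Db_T_paid` + `stubD7αMemDockPerMeasureT_toW1`.
(print: Rogawski1990, Thm. 13.3.7; §13.1 Prop. 13.1.3 (d), 13.1.4 on C_c^∞) (print: GelbartRogawski1991, Lem. 5.1.2; Thm. 5.1.1) (print: Liu2021, Def. 4.11, Prop. 4.13) -/
theorem stub_D7αMemDockμTW1 : Summit.HodgeConjecture.HodgeConjecture.Cruxes.H413.F0P2oD7alphaMemDockStatementW1.StubD7αMemDockPerMeasureTW1 := by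
  sorry

/-- **MONOTONICITY PROBE (v1.16, no `sorry`)**: the v1.15 node `StubD7αMemDockPerMeasureT` implies the W1 node — the re-typing only WEAKENS (★ p849450
`F0P2oD7alphaMemDockStatementW1.stubD7αMemDockPerMeasureT_toW1`, over ★ `cmThetaDockingClausesTest_toW1`). -/
theorem stubD7αMemDockPerMeasureTW1_of_T (h : Summit.HodgeConjecture.HodgeConjecture.Cruxes.H413.F0P2oD7alphaMemDockStatement.StubD7αMemDockPerMeasureT) :
    Summit.HodgeConjecture.HodgeConjecture.Cruxes.H413.F0P2oD7alphaMemDockStatementW1.StubD7αMemDockPerMeasureTW1 :=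
  Summit.HodgeConjecture.HodgeConjecture.Cruxes.H413.F0P2oD7alphaMemDockStatementW1.stubD7αMemDockPerMeasureT_toW1 h

set_option synthInstance.maxHeartbeats 400000 in
set_option maxHeartbeats 8000000 in
/-- **MONOTONICITY PROBE (v1.14, no `sorry`)**: the v1.13 registered statement `StubD7αMemDock` (data BEFORE `∀ μ`) implies the per-measure node — the re-cut only WEAKENS. -/
theorem stubD7αMemDockPerMeasure_of_uniform (h : StubD7αMemDock) : Summit.HodgeConjecture.HodgeConjecture.Cruxes.H413.F0P2oD7alphaMemDockStatement.StubD7αMemDockPerMeasure := by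
  intro L _ _ _ ι H T hT hdef h2 μω hμu hquad μ _
  obtain ⟨Δ, mH, mG, νG, νH, ξloc, μZ, keys, hCM, hHaar, hDock, hMem⟩ := h L ι H T hT hdef h2 μω hμu hquad
  refine ⟨Δ, mH, mG, νG, νH, ξloc, μZ, keys, hCM, hHaar, hDock, ?_⟩
  intro W _ _ σ hi hs ha P hP hfin ξ hξ v hv c hc
  exact hMem μ W σ hi hs ha P hP hfin ξ hξ v hv c hc

set_option synthInstance.maxHeartbeats 400000 in
set_option maxHeartbeats 16000000 in
/-- **RIGf (dictionary form, W1) ⟸ MEM+DOCK-W1 + #75-loc** (v1.7; no `sorry` in this declaration; v1.16: over the W1 node via ★ p849454 `d7alpha_packet_members_thetaClassTestW1`, the two W1 binders `hw haut` of `StubRIGfDict` threaded into the dock): ★ ISO-BRIDGE `exists_isoAtXfCM_of_forall_mem` over ★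
`d7alpha_packet_members_thetaClassTest` (v1.15 «DOCK-T»: packet-level Test glue ★ p840385 at the node՚s SHAPE witnesses; v1.7–v1.14: `d7alpha_members_thetaClass` at the record family) (`IsoAtXf` here and ★ `IsoAtXfCM` agree definitionally). (print: Rogawski1990, Thm. 13.3.6 (c); Prop. 13.1.3 (d)) -/
theorem stub_RIGfDict : StubRIGfDict := by
  intro L _ _ _ ι H T hT hdef h2 n' e₁ dV hdV hdV0 g hg μ _ μω hμu hquad W _ _ σ hi hs ha P hP hfin ξ hMem μ1 hμ1 χf hc hu hw haut hdμ hdχ v hv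
  letI : ∀ v : HeightOneSpectrum (𝓞 ↥(maximalRealSubfield L)), MeasurableSpace ((cmDatum L 3 H).Local v) := fun _ => borel _
  letI : ∀ v : HeightOneSpectrum (𝓞 ↥(maximalRealSubfield L)),
      MeasurableSpace ((cmDatum L 2 (Matrix.of fun i j : Fin 2 => if i.val + j.val + 1 = 2 then (1 : L) else 0)).Local v ×
        (cmDatum L 1 (Matrix.of fun i j : Fin 1 => if i.val + j.val + 1 = 1 then (1 : L) else 0)).Local v) := fun _ => borel _
  letI : ∀ (v : HeightOneSpectrum (𝓞 ↥(maximalRealSubfield L)))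
      (a : ((cmDatum L 2 (Matrix.of fun i j : Fin 2 => if i.val + j.val + 1 = 2 then (1 : L) else 0)).Local v ×
        (cmDatum L 1 (Matrix.of fun i j : Fin 1 => if i.val + j.val + 1 = 1 then (1 : L) else 0)).Local v)),
      MeasurableSpace (((cmDatum L 2 (Matrix.of fun i j : Fin 2 => if i.val + j.val + 1 = 2 then (1 : L) else 0)).Local v ×
          (cmDatum L 1 (Matrix.of fun i j : Fin 1 => if i.val + j.val + 1 = 1 then (1 : L) else 0)).Local v) ⧸
        Subgroup.centralizer ({a} : Set ((cmDatum L 2 (Matrix.of fun i j : Fin 2 => if i.val + j.val + 1 = 2 then (1 : L) else 0)).Local v ×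
          (cmDatum L 1 (Matrix.of fun i j : Fin 1 => if i.val + j.val + 1 = 1 then (1 : L) else 0)).Local v))) := fun _ _ => borel _
  letI : ∀ (v : HeightOneSpectrum (𝓞 ↥(maximalRealSubfield L))) (γ : (cmDatum L 3 H).Local v),
      MeasurableSpace ((cmDatum L 3 H).Local v ⧸ Subgroup.centralizer ({γ} : Set ((cmDatum L 3 H).Local v))) := fun _ _ => borel _
  letI : ∀ v : HeightOneSpectrum (𝓞 ↥(maximalRealSubfield L)), MeasurableSpace (Gqs L v ⧸ Subgroup.center (Gqs L v)) := fun _ => borel _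
  haveI : BorelSpace (Gqs L v ⧸ Subgroup.center (Gqs L v)) := ⟨rfl⟩
  obtain ⟨Δ, mH, mG, νG, νH, ξloc, μZ, packFin, hHaar, -, hDock, hShape, hMemRec⟩ := stub_D7αMemDockμTW1 L ι H T hT hdef h2 μω hμu hquad μ
  haveI : (μZ v).IsHaarMeasure := hHaar v
  obtain ⟨Tm, a₀, ha₀, h₀, π2, πn, πs, hK, hs2, hn, hsc, hne, hId, hpack⟩ := hShape ξ v hv
  exact F0P2oIsoAtXfOfThetaTypeAt.exists_isoAtXfCM_of_forall_mem L H e₁ dV hdV hdV0 g hg σ μ1 hμ1 χf hi ha v _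
    (fun c hcst => hMemRec W σ hi hs ha P hP hfin ξ hMem v hv c hcst)
    (fun c hmem => F0P2oD7alphaMembersThetaClassTestW1.d7alpha_packet_members_thetaClassTestW1 L H
      (transpose_map_cmConjRingHom_eq_of_frame L ι H T hT) (isUnit_det_of_frame L ι H T hT) μω hμu Δ mH mG νG νH ξloc
      xiLocalPacket_nonsplit_isThetaPair_of_stubs e₁ dV hdV hdV0 g hg ξ (hDock e₁ dV hdV hdV0 g hg ξ) hquad μ1 hμ1 χf hc hu hw haut hdμ hdχ v hv (μZ v)
      Tm a₀ ha₀ h₀ π2 πn hK hs2 hn πs hsc hne hId c (by rw [hpack] at hmem; exact hmem))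

/-! ## §3 THE HEAD (kernel-checked composition) and the one concluder by name -/

set_option synthInstance.maxHeartbeats 400000 in
set_option maxHeartbeats 16000000 in
/-- **PKΠ ⟸ S2♯ + GR91N + RIGf (GRD pinned at the DICT-CHOICE witness, RIG∞ discharged in-house, ★LTY by name)** (the v1.4 composition; no `sorry`).
★ `exists_muOmega` (Hewitt–Ross) supplies Rogawski's `μω`; S2♯ gives `ξ` with `MemXiFamily P … ξ` and the arch pin `XiArchPinned L ξ μω k` directly from the
cotangent binder `hP`; the witness `(μ_ξ, χ_f) := (grdMu …, grdChi …)` (p819322) is conjugate-symplectic ∕ continuous ∕ unitary by name; GRD's finite matrix at the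
witness is A-p17's pinned core over the PRINT letter GR91N; RIG∞ (weight one of `μ_ξ`, automorphy of `χ_f`) is ★ `rigInf_node_of_xiArchPinned`; split places: ★ CL
`stubCL_holds` + ★ LTY-c `exists_member_isConstituentOf_localType` + (S); non-split places: RIGf at the witness.
[cite: Rogawski1990, Thm. 13.3.6 (c), §13.1 p. 199, Prop. 15.2.1 (b)] [cite: GelbartRogawski1991, Lem 5.1.2 p. 466] -/
theorem pkPi_of_rung4 (hS2 : S2SharpExport) (hGR : Literature.NumberTheory.GelbartRogawski1991.GR91Lemma512NonsplitAsPrinted) (hRIGf : StubRIGfDict) :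
    PKPiRecorded := by
  intro L _ _ _ ι H T hT hdef h2 n' e₁ dV hdV hdV0 g hg ιV hιV μ _ W _ _ σ hirr hsm hadm P hP hfin
  obtain ⟨μω, hμu, hquad⟩ := exists_muOmega L
  obtain ⟨ξ, k, hmem, hpin⟩ := hS2 L ι H T hT hdef h2 μ μω hμu hquad P hP
  have hμ1 : IsConjugateSymplectic L (F0P2iGRDWitness.grdMu L ξ μω hμu) :=
    F0P2iGRDWitness.isConjugateSymplectic_grdMu L ξ μω hμu hquad
  have hcont : Continuous (F0P2iGRDWitness.grdChi L ξ μω hquad) := F0P2iGRDWitness.continuous_grdChi L ξ μω hquad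
  have hunit : ∀ z, ‖((F0P2iGRDWitness.grdChi L ξ μω hquad z : ℂˣ) : ℂ)‖ = 1 := F0P2iGRDWitness.norm_grdChi_apply L ξ hμu hquad
  have hm : GRDMatrix L H (transpose_map_cmConjRingHom_eq_of_frame L ι H T hT) (isUnit_det_of_frame L ι H T hT) e₁ dV hdV hdV0 g hg ξ μω hμu
      (F0P2iGRDWitness.grdMu L ξ μω hμu) hμ1 (F0P2iGRDWitness.grdChi L ξ μω hquad) :=
    F0P2iGRDAssembly.grdMatrix_grdMu_grdChi_of_GR91N hGR L H (transpose_map_cmConjRingHom_eq_of_frame L ι H T hT)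
      (isUnit_det_of_frame L ι H T hT) e₁ dV hdV hdV0 g hg ξ μω hμu hquad
  obtain ⟨hw, haut⟩ := F0P2iRIGinfDischarge.rigInf_node_of_xiArchPinned L ξ μω k hpin (F0P2iGRDWitness.grdMu L ξ μω hμu)
    (F0P2iGRDWitness.toHeckeCharacter_grdMu L ξ μω hμu) (F0P2iGRDWitness.grdChi L ξ μω hquad)
    (F0P2iGRDWitness.grdChi_finAdelicCheck L ξ μω hquad (complexConj_mul_complexConj' L))
  refine ⟨F0P2iGRDWitness.grdMu L ξ μω hμu, hμ1, hw, ⟨F0P2iGRDWitness.grdChi L ξ μω hquad, haut⟩, fun v => ?_⟩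
  by_cases hs : ∃ w : PlacesOver L v, IsCMField.complexConj L • w.1 ≠ w.1
  · -- SPLIT place: LTY BY NAME (★ CL `stubCL_holds`: a local type `τ` exists; ★ p816375: some member `c ∈ Pv v` is carried by `τ`) + (S)
    obtain ⟨T₀, iT₁, iT₂, τ, hτ, htop⟩ :=
      stubCL_holds (↥(maximalRealSubfield L)) L (IsCMField.complexConj L) 3 H W σ hirr hadm v
    obtain ⟨Pv, hfam, hmemτ⟩ := exists_member_isConstituentOf_localType P hirr hsm hfin hmem
    obtain ⟨c, hc, hconst⟩ := hmemτ v T₀ τ hτ htop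
    obtain ⟨ε, hΘ⟩ := hm.1 Pv hfam v hs c hc
    exact ⟨ε, hΘ T₀ τ hτ hconst W (σ.comp (inclPlace (↥(maximalRealSubfield L)) L (IsCMField.complexConj L) 3 H v)) htop⟩
  · push Not at hs
    obtain ⟨ε, hε⟩ := hRIGf L ι H T hT hdef h2 e₁ dV hdV hdV0 g hg μ μω hμu hquad W σ hirr hsm hadm P hP hfin ξ hmem
      (F0P2iGRDWitness.grdMu L ξ μω hμu) hμ1 (F0P2iGRDWitness.grdChi L ξ μω hquad) hcont hunit hw haut
      (F0P2iGRDWitness.semilocalComponent_toHeckeCharacter_grdMu L ξ μω hμu)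
      (F0P2iGRDWitness.grdChi_finAdelicCheck L ξ μω hquad (complexConj_mul_complexConj' L)) v hs
    exact ⟨ε, hε⟩

/-- **THE ONE CONCLUDER BY NAME**: the registered stubs compose to `PKPiTarget` (PKΠ verbatim); v1.4: {S2♯, GR91N, D7α ↦ RIGf} — print letters only;
v1.5: GR91N ↦ {N3, K1w, U1} by name (★ twin `GR91N_of_letters`), so the `sorry`s are {S2♯, N3, K1w, U1, D7α}. -/
theorem stubPKPi_of_rung4_stubs : PKPiTarget :=
  pkPi_of_rung4 (s2SharpExport_of_C2sharp stub_S2sharp) stub_GR91N stub_RIGfDict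

/-! ## §4 Bookkeeping (sorry-free, no stubs): the bridges by `Iff.rfl` and the projections of the dictionary predicate -/

set_option synthInstance.maxHeartbeats 400000 in
set_option maxHeartbeats 8000000 in
/-- `IsoAt` at an automorphic `χ = ⟨χf, h⟩` IS `IsoAtXf` at `χf` (the matrix reads `χ` only through `χ.1`). -/
theorem isoAt_chi_mk (L : Type) [Field L] [NumberField L] [IsCMField L] (H : Matrix (Fin 3) (Fin 3) L) {n' : ℕ} (e₁ : Fin 3 × Fin 1 ≃ Fin n')
    (dV : Fin 3 → L) (hdV : ∀ i, IsCMField.complexConj L (dV i) = dV i) (hdV0 : ∀ i, dV i ≠ 0) (g : GL (Fin 3) L)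
    (hg : ((g : Matrix (Fin 3) (Fin 3) L).map (cmConjRingHom L))ᵀ * H * (g : Matrix (Fin 3) (Fin 3) L) = Matrix.diagonal dV)
    {W : Type} [AddCommGroup W] [Module ℂ W] (σ : Representation ℂ (finAdelic (↥(maximalRealSubfield L)) L (IsCMField.complexConj L) 3 H) W)
    (μ : Literature.NumberTheory.Automorphic.IdeleClassGroup L →ₜ* Circle) (hμ : IsConjugateSymplectic L μ)
    (χf : UnitaryGroup.finAdelicOne (↥(maximalRealSubfield L)) L (IsCMField.complexConj L) →* ℂˣ)
    (h : IsAutomorphicOneChar (↥(maximalRealSubfield L)) L (IsCMField.complexConj L) χf) (ε : (↥(maximalRealSubfield L))ˣ)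
    (v : HeightOneSpectrum (𝓞 ↥(maximalRealSubfield L))) :
    IsoAt L H e₁ dV hdV hdV0 g hg σ μ hμ ⟨χf, h⟩ ε v ↔ IsoAtXf L H e₁ dV hdV hdV0 g hg σ μ hμ χf ε v :=
  Iff.rfl

/-- The split clause (S) of the dictionary predicate. -/
theorem grdMatrix_split {L : Type} [Field L] [NumberField L] [IsCMField L] {H : Matrix (Fin 3) (Fin 3) L} {hH : (H.map (cmConjRingHom L))ᵀ = H}
    {hHd : IsUnit H.det} {n' : ℕ} {e₁ : Fin 3 × Fin 1 ≃ Fin n'} {dV : Fin 3 → L} {hdV : ∀ i, IsCMField.complexConj L (dV i) = dV i} {hdV0 : ∀ i, dV i ≠ 0}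
    {g : GL (Fin 3) L} {hg : ((g : Matrix (Fin 3) (Fin 3) L).map (cmConjRingHom L))ᵀ * H * (g : Matrix (Fin 3) (Fin 3) L) = Matrix.diagonal dV}
    {ξ : OneDimAutRepH L} {μω : HeckeCharacter L} {hμu : μω.IsUnitary}
    {μ : Literature.NumberTheory.Automorphic.IdeleClassGroup L →ₜ* Circle} {hμ : IsConjugateSymplectic L μ}
    {χf : UnitaryGroup.finAdelicOne (↥(maximalRealSubfield L)) L (IsCMField.complexConj L) →* ℂˣ}
    (hm : GRDMatrix L H hH hHd e₁ dV hdV hdV0 g hg ξ μω hμu μ hμ χf)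
    {Pv : ∀ v : HeightOneSpectrum (𝓞 ↥(maximalRealSubfield L)), CMLocalAPacket L H v} (hfam : ξ.IsXiLocalFamily hH hHd μω hμu Pv)
    (v : HeightOneSpectrum (𝓞 ↥(maximalRealSubfield L))) (hs : ∃ w : PlacesOver L v, IsCMField.complexConj L • w.1 ≠ w.1)
    (c : IrrClass ((cmDatum L 3 H).Local v)) (hc : c ∈ (Pv v).members) :
    ∃ ε : (↥(maximalRealSubfield L))ˣ, ThetaTypeAt L H e₁ dV hdV hdV0 g hg μ hμ χf ε v c :=
  hm.1 Pv hfam v hs c hc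

/-- The pull-back of PKΠ to the rung-3 interface: `PKPiRecorded` IS `PKPiTarget`. -/
theorem pkPiRecorded_iff : PKPiRecorded ↔ PKPiTarget :=
  Iff.rfl

end Summit.HodgeConjecture.HodgeConjecture.Cruxes.H413.F0P2PKPiRung4

end
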